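import Literature.Probability.LatticeModels.FKIsingTopologicalRectangleCrossingProofs
import Literature.Probability.LatticeModels.UnitCurrentFlow
import HarnessLib

/-!
# The RW partition function of a discrete domain is bounded by the inverse extremal length
# (Chelkak–Duminil-Copin–Hongler 2016, Thm. 3.9, second assertion; Chelkak 2016, Prop. 6.6)

Topic `Literature/Probability/LatticeModels` (family `crit-ising`); a PROVED input of the printed proof of
CDH16 Thm. 1.1 (`fkIsing_topologicalRectangle_crossingBounds`, file
`FKIsingTopologicalRectangleCrossing.lean`), in the vocabulary of `DiscreteRWPartitionFunction.lean`
(`DiscreteRect.rwZ E x y = Z_Ω[x,y]`, `DiscreteRect.rwZSets`, masses `DiscreteRect.mass`, `DiscreteRect.wExt`)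
and `EffectiveResistance.lean` (`effectiveConductance`, `effectiveResistance` = the discrete extremal length
`ℓ_Ω` by Duffin's theorem). No named facts.

Sources (held texts `lit read arxiv:1312.7785`, `lit read arxiv:1212.6205`):

* D. Chelkak, H. Duminil-Copin, C. Hongler, *Crossing probabilities in topological rectangles for the
  critical planar FK-Ising model*, Electron. J. Probab. 21 (2016), no. 5, **Theorem 3.9** ([Che12]): "There
  exist two continuous decreasing functions `ζ₁, ζ₂ : ℝ₊ → ℝ₊` such that, for all topological rectangles
  `(Ω,a,b,c,d)`, if `ℓ_Ω̄[(a_ext b_ext),(c_ext d_ext)] ≤ L`, then `Z_Ω[(ab),(cd)] ≥ ζ₁(L)`; if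
  `ℓ_Ω̄[(a_ext b_ext),(c_ext d_ext)] ≥ L`, then `Z_Ω[(ab),(cd)] ≤ ζ₂(L)`. Moreover … `ζ₂(L) → 0` as
  `L → ∞`"; it is the second assertion that §4.3 uses in `Ω` ("If `L₀ = L₀(ζ₀')` is chosen large enough,
  then Theorem 3.9 and the lower bound in (4.6) [`L₀ ≤ ℓ_Ω[(ab),(cd)]`] yield `Z_Ω[(ab),(cd)] ≤ ζ₀'`").
* D. Chelkak, *Robust discrete complex analysis: a toolbox*, Ann. Probab. 44 (2016) = arXiv:1212.6205,
  **Proposition 6.6**, first display: "`Z_Ω([ab]_Ω;[cd]_Ω) ≤ const · (L_Ω([ab]_Ω;[cd]_Ω))⁻¹`, where `const`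
  does not depend on `Ω, a, b, c, d`", proved from Prop. 6.4 (Duffin: `L⁻¹ = I(V)`, the current of the
  Dirichlet–Neumann potential `V`) and "`V(x_int) ≥ const · Z_Ω(x_int;[cd]_Ω)`".

## Main results (all proved)

* `DiscreteRect.rwZSets_le_inv_wExt_sq_mul_effectiveConductance`: for every connected discrete domain
  `Ω = ⟨E⟩ ⊆ ℤ²` and any two sets `A, C ⊆ ∂Ω` of boundary vertices,
  `Z_Ω[A,C] ≤ w_ext⁻² · 𝒞_Ω(A ↔ C)`, `𝒞 = ℓ⁻¹` the effective conductance with unit conductances and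
  `w_ext⁻² = (3 + 2√2)/4` (`DiscreteRect.inv_wExt_sq`); transferred to the network `⟨E⟩` on `ℤ²`
  (`…_mul_inv_resistance`) and specialised to the arcs of a discrete topological rectangle
  `DiscreteRect.IsRect E d₀ n` (`IsRect.rwZSets_arcVerts_le_inv_wExt_sq_mul_inv_resistance`), and in the shape
  of CDH16 Thm. 3.9 (ii) with the explicit `ζ₂(L) = (w_ext² L)⁻¹` (`IsRect.rwZSets_arcVerts_le_of_le_resistance`).
  The statement with the inner arcs and `ℓ_Ω` is the one used in CDH16 §4.3; since `ℓ_Ω ≤ ℓ_Ω̄`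
  (`DiscreteExtremalLengthExternalArcs`), the printed hypothesis `ℓ_Ω̄ ≥ L` is weaker than `ℓ_Ω ≥ L`:
* `DiscreteRect.IsRect.rwZSets_arcVerts_le_mul_inv_extResistance` and
  `DiscreteRect.IsRect.rwZSets_arcVerts_le_of_le_extResistance`: **the printed form** — for any two arcs
  `j, j'` of a discrete topological rectangle, `Z_Ω[(arc j),(arc j')] ≤ ((1 + w_ext)/w_ext²) · ℓ_Ω̄⁻¹` with
  `ℓ_Ω̄ = DiscreteRect.extResistance E d₀ n j j'` the resistance of the completed graph `Ω̄` between the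
  EXTERNAL arcs (`DiscreteExtremalLengthExternalArcs.lean`), hence "`ℓ_Ω̄ ≥ L ⇒ Z_Ω ≤ ζ₂(L)`" with
  `ζ₂(L) = (1 + w_ext)/(w_ext² L)`. Here the harmonic interpolant is replaced by the penalised (Robin-type)
  interpolant `ΔN + (α + γ)N = α` of `Ω` (`α_u, γ_u` = numbers of darts of the two arcs based at `u`: the
  elimination of the pendant vertices of `Ω̄`), whose current is at most `𝒞_Ω̄` because the energy of `Ω̄`
  dominates the penalised energy of `Ω` (`IsRect.inner_add_pendant_le_networkEnergy_extGraph`).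

## The proof (Chelkak's argument, with the reflecting-walk comparison replaced by a Green pairing)

1. Finite networks (`networkLaplacian` of `UnitCurrentFlow.lean`): existence of the harmonic interpolant `N`
   of two disjoint vertex sets (`N = 1` on `A`, `0` on `C`, `ΔN = 0` elsewhere; the pinned Laplacian is
   injective by the energy identity, hence surjective — Lyons–Peres 2016, §2.1), Dirichlet's principle
   `𝒞(A ↔ C) = 𝓔(N) = Σ_{a ∈ A} ΔN(a)` (Exercise 2.13; the two-set version of
   `effectiveConductance_eq_of_harmonic`), and the discrete maximum principle (`0 ≤ N ≤ 1`).
2. The random walk of CDH16 §3.1: first-step decomposition `m_x Z_Ω[x,y] = 1[x=y] + Σ_{u∼x} Z_Ω[u,y]`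
   (from the level sums of `FKIsingTopologicalRectangleCrossingProofs.lean`), hence
   `Δ Z_Ω[·,y] = 1_y − (m − deg) Z_Ω[·,y]` with killing rate `m_x − deg x ≥ w_ext · 1[x ∈ ∂Ω]`, the mass
   conservation `Σ_x (m_x − deg x) Z_Ω[x,y] = 1` and the bound `Σ_{y ∈ C} Z_Ω[u,y] ≤ w_ext⁻¹` for `C ⊆ ∂Ω`.
3. Green's identity `Σ N ΔZ_y = Σ Z_y ΔN` for each pole `y ∈ C` gives
   `w_ext Σ_{a∈A} Z_Ω[a,y] ≤ Σ_{c∈C} Z_Ω[c,y] (−ΔN)(c)`; summing over `y ∈ C` and using 2,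
   `w_ext Z_Ω[A,C] ≤ w_ext⁻¹ Σ_{c∈C} (−ΔN)(c) = w_ext⁻¹ Σ_{a∈A} ΔN(a) = w_ext⁻¹ 𝒞(A ↔ C)`.
4. For the external arcs: the penalised interpolant (existence, `0 ≤ N ≤ 1`, penalised Dirichlet
   principle `Q(f) ≥ Q(N) = Σ α(1 - N) = Σ γ N`), the same pairing now reading
   `w_ext Σ_{a} Z_Ω[a,y] ≤ N(y) + Σ_u γ_u N(u) Z_Ω[u,y]`, and `Σ γ N ≤ 𝒞_Ω̄`.

Mathlib anchors: `SimpleGraph.Walk`, `SimpleGraph.finsetWalkLength`, `LinearMap.injective_iff_surjective`,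
`tsum` on `ℝ≥0∞`. Mathlib has neither random walks on graphs nor discrete potential theory of finite networks.

## References
* [ChelkakDuminilCopinHongler2016] D. Chelkak, H. Duminil-Copin, C. Hongler, EJP 21 (2016) no. 5, Thm. 3.9,
  §3.1, §4.3.
* [Chelkak2016] D. Chelkak, Ann. Probab. 44 (2016), Prop. 6.4, Prop. 6.6 (arXiv:1212.6205, p. 23 of the held
  text).
* [LyonsPeres2016] R. Lyons, Y. Peres, *Probability on Trees and Networks*, CUP 2016, §2.1 (harmonic
  functions, maximum, uniqueness and existence principles), §2.4 Exercise 2.13 (Dirichlet's principle).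
-/

noncomputable section

open scoped ENNReal NNReal
open SimpleGraph Finset

namespace Literature.Probability.LatticeModels



/-! ### Harmonic interpolation between two vertex sets of a finite network -/

section HarmonicInterpolant

variable {V : Type*} [Fintype V] [DecidableEq V] (G : SimpleGraph V) [DecidableRel G.Adj]
  (c : Sym2 V → ℝ≥0)

/-- **Existence of the harmonic interpolant** (solution of the discrete Dirichlet problem with two
boundary sets): on a finite connected network with positive conductances, for disjoint vertex sets
`A, C` there is a potential equal to `1` on `A`, to `0` on `C` and with vanishing weighted Laplacian
off `A ∪ C` (Lyons–Peres 2016, §2.1, existence and uniqueness principles: the pinned Laplacian is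
injective on the finite-dimensional space of potentials, hence surjective). [cite: LyonsPeres2016, §2.1, Existence and Uniqueness Principles] -/
theorem exists_harmonic_interpolant (hG : G.Preconnected) (hc : ∀ e ∈ G.edgeSet, 0 < c e)
    {A C : Set V} (hAC : Disjoint A C) :
    ∃ N : V → ℝ, (∀ z ∈ A, N z = 1) ∧ (∀ z ∈ C, N z = 0) ∧
      ∀ z, z ∉ A → z ∉ C → networkLaplacian G c N z = 0 := by
  classical
  by_cases hS : ∃ s, s ∈ A ∨ s ∈ C
  swap
  · push Not at hS
    exact ⟨fun _ ↦ 0, fun z hz ↦ ((hS z).1 hz).elim, fun _ _ ↦ rfl,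
      fun z _ _ ↦ networkLaplacian_zero G c z⟩
  obtain ⟨s, hs⟩ := hS
  let P : V → Prop := fun z ↦ z ∈ A ∨ z ∈ C
  let M : (V → ℝ) →ₗ[ℝ] (V → ℝ) :=
    { toFun := fun f z ↦ if P z then f z else networkLaplacian G c f z
      map_add' := fun f g ↦ by
        funext z
        change (if P z then f z + g z else networkLaplacian G c (fun y ↦ f y + g y) z) =
          (if P z then f z else networkLaplacian G c f z) +
            (if P z then g z else networkLaplacian G c g z)
        rw [networkLaplacian_add]
        split_ifs <;> rfl
      map_smul' := fun t f ↦ by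
        funext z
        change (if P z then t * f z else networkLaplacian G c (fun y ↦ t * f y) z) =
          t * (if P z then f z else networkLaplacian G c f z)
        rw [networkLaplacian_smul]
        split_ifs <;> rfl }
  have hM : ∀ f z, M f z = if P z then f z else networkLaplacian G c f z := fun f z ↦ rfl
  have hinj : Function.Injective M := by
    refine (injective_iff_map_eq_zero M).2 fun f hf ↦ ?_
    have hfz : ∀ z, M f z = 0 := fun z ↦ by rw [hf]; rfl
    have hP : ∀ z, P z → f z = 0 := fun z hz ↦ by
      have h := hfz z
      rwa [hM, if_pos hz] at h
    have hW : ∀ z, ¬ P z → networkLaplacian G c f z = 0 := fun z hz ↦ by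
      have h := hfz z
      rwa [hM, if_neg hz] at h
    have hE : ∑ e ∈ G.edgeFinset, (c e : ℝ) * sqIncr f e = 0 := by
      rw [← sum_mul_networkLaplacian_self]
      refine Finset.sum_eq_zero fun z _ ↦ ?_
      by_cases hz : P z
      · rw [hP z hz, zero_mul]
      · rw [hW z hz, mul_zero]
    have hstep : ∀ (x y : V) (p : G.Walk x y), f x = f y := by
      intro x y p
      induction p with
      | nil => rfl
      | cons hadj _ ih =>
        exact (eq_of_energy_eq_zero G c hE ⟨hadj, hc _ ((mem_edgeSet G).2 hadj)⟩).trans ih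
    funext z
    obtain ⟨p⟩ := hG z s
    rw [hstep z s p, hP s hs]
    rfl
  obtain ⟨N, hN⟩ := LinearMap.injective_iff_surjective.1 hinj fun z ↦ if z ∈ A then 1 else 0
  have hNz : ∀ z, M N z = if z ∈ A then 1 else 0 := fun z ↦ by rw [hN]
  refine ⟨N, fun z hz ↦ ?_, fun z hz ↦ ?_, fun z hzA hzC ↦ ?_⟩
  · have h := hNz z
    rwa [hM, if_pos (Or.inl hz), if_pos hz] at h
  · have hzA : z ∉ A := fun h ↦ hAC.ne_of_mem h hz rfl
    have h := hNz z
    rwa [hM, if_pos (Or.inr hz), if_neg hzA] at h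
  · have h := hNz z
    rwa [hM, if_neg (by rintro (h' | h'); exacts [hzA h', hzC h']), if_neg hzA] at h

/-- **Dirichlet's principle for the harmonic interpolant of two sets**: if `N = 1` on `A`, `N = 0`
on `C` and the weighted Laplacian of `N` vanishes off `A ∪ C`, then `N` minimises the Dirichlet
energy among admissible potentials, so `𝒞(A ↔ C)` is the energy of `N` (Lyons–Peres 2016,
Exercise 2.13). [cite: LyonsPeres2016, §2.4, Exercise 2.13] -/
theorem effectiveConductance_eq_networkEnergy_of_harmonic {A C : Set V} (N : V → ℝ)
    (hA : ∀ z ∈ A, N z = 1) (hC : ∀ z ∈ C, N z = 0)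
    (hW : ∀ z, z ∉ A → z ∉ C → networkLaplacian G c N z = 0) :
    effectiveConductance G c A C = networkEnergy G c N := by
  set E : (V → ℝ) → ℝ := fun v ↦ ∑ e ∈ G.edgeFinset, (c e : ℝ) * sqIncr v e with hE
  have hEv : ∀ v : V → ℝ, A.EqOn v 1 → C.EqOn v 0 → E N ≤ E v := fun v hvA hvC ↦ by
    have hcross : ∑ e ∈ G.edgeFinset, (c e : ℝ) *
        Sym2.lift ⟨fun a b ↦ ((v a - N a) - (v b - N b)) * (N a - N b), fun a b ↦ by ring⟩ e
          = 0 := by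
      rw [sum_edgeFinset_mul_incr G c (fun z ↦ v z - N z) N]
      refine sum_eq_zero fun z _ ↦ ?_
      by_cases hzA : z ∈ A
      · have h1 : v z = 1 := hvA hzA
        rw [h1, hA z hzA, sub_self, zero_mul]
      · by_cases hzC : z ∈ C
        · have h0 : v z = 0 := hvC hzC
          rw [h0, hC z hzC, sub_self, zero_mul]
        · have h := hW z hzA hzC
          rw [networkLaplacian_apply] at h
          rw [h, mul_zero]
    have hsplit : E v = E N + 2 * ∑ e ∈ G.edgeFinset, (c e : ℝ) *
        Sym2.lift ⟨fun a b ↦ ((v a - N a) - (v b - N b)) * (N a - N b), fun a b ↦ by ring⟩ e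
          + E (fun z ↦ v z - N z) := by
      simp only [hE, mul_sum, ← sum_add_distrib]
      refine sum_congr rfl fun e _ ↦ ?_
      rw [sqIncr_eq_sqIncr_add v N e]
      ring
    have hnonneg : 0 ≤ E (fun z ↦ v z - N z) :=
      sum_nonneg fun e _ ↦ mul_nonneg (NNReal.coe_nonneg _) (sqIncr_nonneg _ e)
    rw [hsplit, hcross, mul_zero, add_zero]
    linarith
  refine le_antisymm (effectiveConductance_le_networkEnergy (fun z hz ↦ hA z hz)
    (fun z hz ↦ hC z hz)) (le_effectiveConductance fun v hvA hvC ↦ ?_)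
  rw [networkEnergy_eq_ofReal_sum, networkEnergy_eq_ofReal_sum]
  exact ENNReal.ofReal_le_ofReal (hEv v hvA hvC)

/-- The energy of the harmonic interpolant is the total current out of `A`:
`Σ_e c(e) dN(e)² = Σ_z N(z) (ΔN)(z) = Σ_{z ∈ A} (ΔN)(z)`. [cite: LyonsPeres2016, §2.4, Exercise 2.13] -/
theorem energy_harmonic_eq_sum_filter {A C : Set V} [DecidablePred (· ∈ A)] (N : V → ℝ)
    (hA : ∀ z ∈ A, N z = 1) (hC : ∀ z ∈ C, N z = 0)
    (hW : ∀ z, z ∉ A → z ∉ C → networkLaplacian G c N z = 0) :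
    ∑ e ∈ G.edgeFinset, (c e : ℝ) * sqIncr N e = ∑ z ∈ univ.filter (· ∈ A), networkLaplacian G c N z := by
  rw [← sum_mul_networkLaplacian_self, sum_filter]
  refine sum_congr rfl fun z _ ↦ ?_
  by_cases hzA : z ∈ A
  · rw [if_pos hzA, hA z hzA, one_mul]
  · rw [if_neg hzA]
    by_cases hzC : z ∈ C
    · rw [hC z hzC, zero_mul]
    · rw [hW z hzA hzC, mul_zero]

omit [DecidableEq V] in
/-- **Discrete maximum principle**: on a finite connected network with positive conductances, a
potential whose weighted Laplacian vanishes off a nonempty set `S` is bounded above by its maximum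
on `S` (Lyons–Peres 2016, §2.1, Maximum Principle). [cite: LyonsPeres2016, §2.1, Maximum Principle] -/
theorem le_of_networkLaplacian_eq_zero_off (hG : G.Preconnected) (hc : ∀ e ∈ G.edgeSet, 0 < c e)
    {S : Set V} (hS : S.Nonempty) {N : V → ℝ} {M : ℝ}
    (hN : ∀ z ∉ S, networkLaplacian G c N z = 0) (hM : ∀ s ∈ S, N s ≤ M) (z : V) : N z ≤ M := by
  classical
  obtain ⟨s₀, hs₀⟩ := hS
  obtain ⟨z₀, -, hz₀⟩ := exists_max_image (univ : Finset V) N ⟨s₀, mem_univ _⟩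
  by_contra hcon
  have hmax : M < N z₀ := (not_le.1 hcon).trans_le (hz₀ z (mem_univ _))
  have key : ∀ (x y : V) (p : G.Walk x y), N x = N z₀ → N y = N z₀ := by
    intro x y p
    induction p with
    | nil => exact id
    | cons hadj p ih =>
      rename_i u v w
      intro hu
      apply ih
      have huS : u ∉ S := fun h ↦ by
        have := hM u h
        rw [hu] at this
        exact absurd this (not_le.2 hmax)
      have hL := hN u huS
      rw [networkLaplacian_apply] at hL
      have hterm : ∀ w' ∈ (univ : Finset V),
          0 ≤ (if G.Adj u w' then (c s(u, w') : ℝ) * (N u - N w') else 0) := by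
        intro w' _
        split_ifs
        · refine mul_nonneg (NNReal.coe_nonneg _) (sub_nonneg.2 ?_)
          rw [hu]
          exact hz₀ w' (mem_univ _)
        · exact le_rfl
      have h0 := (sum_eq_zero_iff_of_nonneg hterm).1 hL v (mem_univ _)
      rw [if_pos hadj] at h0
      have hcpos : (0 : ℝ) < c s(u, v) := NNReal.coe_pos.2 (hc _ ((mem_edgeSet G).2 hadj))
      have h1 := (mul_eq_zero.1 h0).resolve_left hcpos.ne'
      linarith [sub_eq_zero.1 h1]
  obtain ⟨p⟩ := hG z₀ s₀
  have h := key z₀ s₀ p rfl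
  have := hM s₀ hs₀
  rw [h] at this
  exact absurd this (not_le.2 hmax)

omit [DecidableEq V] in
/-- **Discrete minimum principle** (the maximum principle for `-N`). [cite: LyonsPeres2016, §2.1, Maximum Principle] -/
theorem ge_of_networkLaplacian_eq_zero_off (hG : G.Preconnected) (hc : ∀ e ∈ G.edgeSet, 0 < c e)
    {S : Set V} (hS : S.Nonempty) {N : V → ℝ} {m : ℝ}
    (hN : ∀ z ∉ S, networkLaplacian G c N z = 0) (hm : ∀ s ∈ S, m ≤ N s) (z : V) : m ≤ N z := by
  have h := le_of_networkLaplacian_eq_zero_off G c hG hc hS (N := fun y ↦ (-1) * N y) (M := -m)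
    (fun z hz ↦ by rw [networkLaplacian_smul, hN z hz, mul_zero])
    (fun s hs ↦ by have := hm s hs; linarith) z
  linarith

end HarmonicInterpolant

/-! ### The random-walk partition function of a lattice domain: first-step identity, Laplacian,
mass conservation -/

section PartitionFunctionLaplacian

namespace DiscreteRect

open scoped Classical

variable {E : Finset (Sym2 (Site 2))}

/-- The level `0` of `Z_Ω[x,y]`: only the trivial path, of weight `m_x⁻¹`, when `x = y`.
[cite: ChelkakDuminilCopinHongler2016, §3.1] -/
theorem sum_walkWeight_finsetWalkLength_zero (x y : ↥((verts E : Finset (Site 2)) : Set (Site 2))) :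
    ∑ p ∈ (graph E).finsetWalkLength 0 x y, walkWeight E p = if x = y then (mass E x.1)⁻¹ else 0 := by
  by_cases hxy : x = y
  · subst hxy
    have h1 : (graph E).finsetWalkLength 0 x x = {Walk.nil} := by
      ext p
      rw [mem_finsetWalkLength_iff, Finset.mem_singleton]
      exact Walk.length_eq_zero_iff.trans Walk.eq_nil_iff_nil.symm
    rw [h1, Finset.sum_singleton, walkWeight_nil, if_pos rfl]
  · have h1 : (graph E).finsetWalkLength 0 x y = ∅ := by
      ext p
      simp only [mem_finsetWalkLength_iff, Finset.notMem_empty, iff_false]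
      intro h
      exact hxy (Walk.eq_of_length_eq_zero h)
    rw [h1, Finset.sum_empty, if_neg hxy]

/-- **First-step decomposition of the partition function**:
`Z_Ω[x,y] = m_x⁻¹ 1[x = y] + m_x⁻¹ Σ_{u ∼ x} Z_Ω[u,y]` — a path from `x` is trivial or starts with a step
to a neighbour (CDH16 §3.1: `Z_Ω[·,y]` is `m_y⁻¹ ×` the Green function of the random walk with generator
`Δ_Ω` killed on `∂_ext Ω`). [cite: ChelkakDuminilCopinHongler2016, §3.1] -/
theorem rwZ_eq_firstStep (x y : ↥((verts E : Finset (Site 2)) : Set (Site 2))) :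
    rwZ E x y = ENNReal.ofReal (if x = y then (mass E x.1)⁻¹ else 0) +
      ENNReal.ofReal (mass E x.1)⁻¹ * ∑ u ∈ (graph E).neighborFinset x, rwZ E u y := by
  have hm : 0 ≤ (mass E x.1)⁻¹ := inv_nonneg.2 (mass_pos E x.1).le
  rw [rwZ_eq_tsum_sum x y, tsum_eq_zero_add' ENNReal.summable, sum_walkWeight_finsetWalkLength_zero]
  congr 1
  have hstep : ∀ n : ℕ, ENNReal.ofReal (∑ p ∈ (graph E).finsetWalkLength (n + 1) x y, walkWeight E p) =
      ENNReal.ofReal (mass E x.1)⁻¹ *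
        ∑ u ∈ (graph E).neighborFinset x, ENNReal.ofReal (∑ q ∈ (graph E).finsetWalkLength n u y, walkWeight E q) := by
    intro n
    rw [sum_walkWeight_finsetWalkLength_succ]
    unfold stepOp
    rw [ENNReal.ofReal_mul hm, ENNReal.ofReal_sum_of_nonneg fun u _ =>
      Finset.sum_nonneg fun q _ => (walkWeight_pos q).le]
  simp_rw [hstep]
  rw [ENNReal.tsum_mul_left]
  congr 1
  rw [Summable.tsum_finsetSum fun u _ => ENNReal.summable]
  exact Finset.sum_congr rfl fun u _ => (rwZ_eq_tsum_sum u y).symm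

/-- The first-step decomposition in real numbers (all partition functions are finite):
`m_x Z_Ω[x,y] = 1[x = y] + Σ_{u ∼ x} Z_Ω[u,y]`. [cite: ChelkakDuminilCopinHongler2016, §3.1] -/
theorem mass_mul_toReal_rwZ (hE : ∀ e ∈ E, e ∈ (zdGraph 2).edgeSet) (x y : ↥((verts E : Finset (Site 2)) : Set (Site 2))) :
    mass E x.1 * (rwZ E x y).toReal =
      (if x = y then 1 else 0) + ∑ u ∈ (graph E).neighborFinset x, (rwZ E u y).toReal := by
  have hm0 : 0 < mass E x.1 := mass_pos E x.1
  have hm : 0 ≤ (mass E x.1)⁻¹ := inv_nonneg.2 hm0.le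
  have h := congrArg ENNReal.toReal (rwZ_eq_firstStep x y)
  have hsum_ne : ∑ u ∈ (graph E).neighborFinset x, rwZ E u y ≠ ⊤ :=
    ENNReal.sum_ne_top.2 fun u _ => rwZ_ne_top hE u y
  rw [ENNReal.toReal_add ENNReal.ofReal_ne_top (ENNReal.mul_ne_top ENNReal.ofReal_ne_top hsum_ne),
    ENNReal.toReal_mul, ENNReal.toReal_ofReal hm, ENNReal.toReal_sum (fun u _ => rwZ_ne_top hE u y),
    ENNReal.toReal_ofReal (by split_ifs <;> [exact hm; exact le_rfl])] at h
  rw [h, mul_add, ← mul_assoc, mul_inv_cancel₀ hm0.ne', one_mul]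
  congr 1
  split_ifs
  · rw [mul_inv_cancel₀ hm0.ne']
  · rw [mul_zero]

/-- **The discrete Laplacian of `Z_Ω[·,y]`**: with unit conductances on `𝓔(Ω)`,
`Σ_{u ∼ x} (Z_Ω[x,y] - Z_Ω[u,y]) = 1[x = y] - (m_x - deg x) Z_Ω[x,y]`; the killing rate
`m_x - deg x = w_ext · #{external darts at x}` is nonnegative and at least `w_ext` on `∂Ω`.
[cite: ChelkakDuminilCopinHongler2016, §3.1] -/
theorem networkLaplacian_toReal_rwZ (hE : ∀ e ∈ E, e ∈ (zdGraph 2).edgeSet) (x y : ↥((verts E : Finset (Site 2)) : Set (Site 2))) :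
    networkLaplacian (graph E) 1 (fun u => (rwZ E u y).toReal) x =
      (if x = y then 1 else 0) - (mass E x.1 - (graph E).degree x) * (rwZ E x y).toReal := by
  rw [networkLaplacian_apply]
  have h1 : ∀ w : ↥((verts E : Finset (Site 2)) : Set (Site 2)), (if (graph E).Adj x w then ((1 : Sym2 ↥((verts E : Finset (Site 2)) : Set (Site 2)) → ℝ≥0) s(x, w) : ℝ) *
      ((rwZ E x y).toReal - (rwZ E w y).toReal) else 0) =
      if (graph E).Adj x w then (rwZ E x y).toReal - (rwZ E w y).toReal else 0 := by
    intro w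
    split_ifs
    · simp
    · rfl
  simp_rw [h1]
  rw [← Finset.sum_filter, show Finset.univ.filter ((graph E).Adj x) = (graph E).neighborFinset x by
    ext w; simp, Finset.sum_sub_distrib, Finset.sum_const, card_neighborFinset_eq_degree, nsmul_eq_mul]
  have h2 := mass_mul_toReal_rwZ hE x y
  linarith

/-- The killing rate is nonnegative: `deg x ≤ m_x`. [cite: ChelkakDuminilCopinHongler2016, §3.1] -/
theorem degree_le_mass (hE : ∀ e ∈ E, e ∈ (zdGraph 2).edgeSet) (x : ↥((verts E : Finset (Site 2)) : Set (Site 2))) :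
    ((graph E).degree x : ℝ) ≤ mass E x.1 := by
  rw [← card_neighborFinset_eq_degree]
  exact card_neighborFinset_le_mass hE x

/-- On the boundary the killing rate is at least `w_ext`: `m_x - deg x ≥ w_ext` for `x ∈ ∂Ω` (at
least one lattice direction at `x` is an external dart, of conductance `w_ext`, and carries no edge
of `Ω`). [cite: ChelkakDuminilCopinHongler2016, §3.1] -/
theorem wExt_le_mass_sub_degree (hE : ∀ e ∈ E, e ∈ (zdGraph 2).edgeSet) {x : ↥((verts E : Finset (Site 2)) : Set (Site 2))}
    (hx : x.1 ∈ bdVerts E) : wExt ≤ mass E x.1 - (graph E).degree x := by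
  obtain ⟨k, -, hk⟩ := hx
  have hdeg : ((graph E).degree x : ℝ) ≤ #({k : Fin 4 | s(x.1, x.1 + dir k) ∈ E} : Finset (Fin 4)) := by
    rw [← card_neighborFinset_eq_degree]
    exact_mod_cast card_neighborFinset_le hE x
  have h3 : (#({k : Fin 4 | s(x.1, x.1 + dir k) ∈ E} : Finset (Fin 4)) : ℝ) ≤ 3 := by
    have hsub : ({k : Fin 4 | s(x.1, x.1 + dir k) ∈ E} : Finset (Fin 4)) ⊆ Finset.univ.erase k := by
      intro j hj
      rw [Finset.mem_filter] at hj
      rw [Finset.mem_erase]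
      refine ⟨?_, Finset.mem_univ _⟩
      rintro rfl
      exact hk hj.2
    have := Finset.card_le_card hsub
    rw [Finset.card_erase_of_mem (Finset.mem_univ _), Finset.card_univ, Fintype.card_fin] at this
    exact_mod_cast this
  rw [mass_eq_card_filter]
  have hw := wExt_pos
  have hw1 := wExt_lt_one
  nlinarith

/-- **Mass conservation of the killed random walk**: `Σ_x (m_x - deg x) Z_Ω[x,y] = 1` — the walk
started at `y` is eventually killed, through some external edge (the Laplacian of `Z_Ω[·,y]` sums to
zero over `Ω`). [cite: ChelkakDuminilCopinHongler2016, §3.1] -/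
theorem sum_mass_sub_degree_mul_toReal_rwZ (hE : ∀ e ∈ E, e ∈ (zdGraph 2).edgeSet) (y : ↥((verts E : Finset (Site 2)) : Set (Site 2))) :
    ∑ x, (mass E x.1 - (graph E).degree x) * (rwZ E x y).toReal = 1 := by
  have h := sum_networkLaplacian (graph E) 1 (fun u => (rwZ E u y).toReal)
  simp_rw [networkLaplacian_toReal_rwZ hE] at h
  rw [Finset.sum_sub_distrib, Finset.sum_ite_eq' Finset.univ y (fun _ => (1 : ℝ)),
    if_pos (Finset.mem_univ y)] at h
  linarith

/-- **Bounded number of boundary visits**: for any set `C` of boundary vertices and any vertex `u`,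
`Σ_{y ∈ C} Z_Ω[u,y] ≤ w_ext⁻¹` (by symmetry and mass conservation: each visit to a boundary vertex is
followed by killing at rate at least `w_ext`). [cite: ChelkakDuminilCopinHongler2016, §3.1] -/
theorem sum_toReal_rwZ_le_inv_wExt (hE : ∀ e ∈ E, e ∈ (zdGraph 2).edgeSet) (u : ↥((verts E : Finset (Site 2)) : Set (Site 2)))
    {C : Finset ↥((verts E : Finset (Site 2)) : Set (Site 2))} (hC : ∀ y ∈ C, y.1 ∈ bdVerts E) :
    ∑ y ∈ C, (rwZ E u y).toReal ≤ wExt⁻¹ := by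
  have hw := wExt_pos
  have h1 : ∀ y ∈ C, (rwZ E u y).toReal ≤ wExt⁻¹ * ((mass E y.1 - (graph E).degree y) * (rwZ E y u).toReal) := by
    intro y hy
    rw [rwZ_comm E u y, ← mul_assoc]
    have hz : 0 ≤ (rwZ E y u).toReal := ENNReal.toReal_nonneg
    have hk : 1 ≤ wExt⁻¹ * (mass E y.1 - (graph E).degree y) := by
      rw [le_inv_mul_iff₀ hw, mul_one]
      exact wExt_le_mass_sub_degree hE (hC y hy)
    nlinarith
  calc ∑ y ∈ C, (rwZ E u y).toReal
      ≤ ∑ y ∈ C, wExt⁻¹ * ((mass E y.1 - (graph E).degree y) * (rwZ E y u).toReal) := Finset.sum_le_sum h1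
    _ ≤ ∑ y, wExt⁻¹ * ((mass E y.1 - (graph E).degree y) * (rwZ E y u).toReal) := by
        refine Finset.sum_le_sum_of_subset_of_nonneg (Finset.subset_univ C) fun y _ _ => ?_
        exact mul_nonneg (inv_nonneg.2 hw.le) (mul_nonneg (sub_nonneg.2 (degree_le_mass hE y))
          ENNReal.toReal_nonneg)
    _ = wExt⁻¹ := by rw [← Finset.mul_sum, sum_mass_sub_degree_mul_toReal_rwZ hE u, mul_one]

end DiscreteRect

end PartitionFunctionLaplacian

/-! ### `Z_Ω[A,C] ≤ w_ext⁻² · 𝒞(A ↔ C)`: the Green pairing and the assembly -/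

section MainBound

namespace DiscreteRect

open scoped Classical

variable {E : Finset (Sym2 (Site 2))}

/-- `w_ext² = 12 - 8√2`, so the constant of the bound is `w_ext⁻² = (3 + 2√2)/4 ≈ 1.457`. [folklore] -/
theorem inv_wExt_sq : (wExt ^ 2)⁻¹ = (3 + 2 * Real.sqrt 2) / 4 := by
  have h2 : Real.sqrt 2 ^ 2 = 2 := Real.sq_sqrt (by norm_num)
  have hw : wExt ^ 2 = 12 - 8 * Real.sqrt 2 := by unfold wExt; nlinarith
  have hne : (12 - 8 * Real.sqrt 2) ≠ 0 := by rw [← hw]; exact (pow_pos wExt_pos 2).ne'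
  rw [hw, inv_eq_iff_eq_inv, eq_comm, inv_eq_of_mul_eq_one_left]
  nlinarith

/-- The unit conductances of `𝓔(Ω)` are positive. [folklore] -/
theorem one_conductance_pos {V : Type*} (G : SimpleGraph V) : ∀ e ∈ G.edgeSet, 0 < (1 : Sym2 V → ℝ≥0) e :=
  fun _ _ => zero_lt_one

/-- The Laplacian of a potential with values in `[0,1]` is nonnegative where the potential equals `1` …
[folklore] -/
theorem networkLaplacian_nonneg_of_eq_one {V : Type*} [Fintype V] (G : SimpleGraph V) [DecidableRel G.Adj]
    {N : V → ℝ} (hN1 : ∀ z, N z ≤ 1) {a : V} (ha : N a = 1) : 0 ≤ networkLaplacian G 1 N a := by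
  rw [networkLaplacian_apply]
  refine Finset.sum_nonneg fun w _ => ?_
  split_ifs
  · simp only [Pi.one_apply, NNReal.coe_one, one_mul, ha, sub_nonneg]
    exact hN1 w
  · exact le_rfl

/-- … and nonpositive where it vanishes. [folklore] -/
theorem networkLaplacian_nonpos_of_eq_zero {V : Type*} [Fintype V] (G : SimpleGraph V) [DecidableRel G.Adj]
    {N : V → ℝ} (hN0 : ∀ z, 0 ≤ N z) {a : V} (ha : N a = 0) : networkLaplacian G 1 N a ≤ 0 := by
  rw [networkLaplacian_apply]
  refine Finset.sum_nonpos fun w _ => ?_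
  split_ifs
  · simp only [Pi.one_apply, NNReal.coe_one, one_mul, ha, zero_sub, neg_nonpos]
    exact hN0 w
  · exact le_rfl

/-- **The Green pairing** (one pole `y ∈ C`): for the harmonic interpolant `N` (`1` on `A`, `0` on `C`,
harmonic off `A ∪ C`, values in `[0,1]`) and `A ⊆ ∂Ω`, Green's identity
`Σ_u N(u) Δ Z_Ω[·,y](u) = Σ_u Z_Ω[u,y] ΔN(u)` together with `Δ Z_Ω[·,y] = 1_y - (m - deg) Z_Ω[·,y]`
gives `w_ext Σ_{a ∈ A} Z_Ω[a,y] ≤ Σ_{c ∈ C} Z_Ω[c,y] (−ΔN)(c)` (cf. Chelkak 2016, proof of Prop. 6.6: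
`V(x_int) ≥ const · Z_Ω(x_int; [cd])`). [cite: Chelkak2016, Prop. 6.6 (proof)] -/
theorem wExt_mul_sum_toReal_rwZ_le (hE : ∀ e ∈ E, e ∈ (zdGraph 2).edgeSet) {A C : Set ↥((verts E : Finset (Site 2)) : Set (Site 2))}
    (hAbd : ∀ x ∈ A, x.1 ∈ bdVerts E) {N : ↥((verts E : Finset (Site 2)) : Set (Site 2)) → ℝ} (hNA : ∀ z ∈ A, N z = 1)
    (hNC : ∀ z ∈ C, N z = 0) (hNW : ∀ z, z ∉ A → z ∉ C → networkLaplacian (graph E) 1 N z = 0)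
    (hN0 : ∀ z, 0 ≤ N z) (hN1 : ∀ z, N z ≤ 1) {y : ↥((verts E : Finset (Site 2)) : Set (Site 2))} (hy : y ∈ C) :
    wExt * ∑ a ∈ Finset.univ.filter (· ∈ A), (rwZ E a y).toReal ≤
      ∑ c ∈ Finset.univ.filter (· ∈ C), (rwZ E c y).toReal * (-networkLaplacian (graph E) 1 N c) := by
  have hZ0 : ∀ u : ↥((verts E : Finset (Site 2)) : Set (Site 2)), 0 ≤ (rwZ E u y).toReal := fun u => ENNReal.toReal_nonneg
  have hκ0 : ∀ u : ↥((verts E : Finset (Site 2)) : Set (Site 2)), 0 ≤ mass E u.1 - (graph E).degree u := fun u => sub_nonneg.2 (degree_le_mass hE u)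
  -- Green's identity
  have hgreen : ∑ u, N u * networkLaplacian (graph E) 1 (fun u => (rwZ E u y).toReal) u =
      ∑ u, (rwZ E u y).toReal * networkLaplacian (graph E) 1 N u :=
    sum_mul_networkLaplacian_comm (graph E) 1 (fun u => (rwZ E u y).toReal) N
  -- the left-hand side
  have hLHS : ∑ u, N u * networkLaplacian (graph E) 1 (fun u => (rwZ E u y).toReal) u =
      -∑ u, (mass E u.1 - (graph E).degree u) * N u * (rwZ E u y).toReal := by
    have h1 : ∀ u, N u * networkLaplacian (graph E) 1 (fun u => (rwZ E u y).toReal) u =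
        (if u = y then N u else 0) - (mass E u.1 - (graph E).degree u) * N u * (rwZ E u y).toReal := by
      intro u
      rw [networkLaplacian_toReal_rwZ hE u y]
      split_ifs <;> ring
    simp_rw [h1]
    rw [Finset.sum_sub_distrib, Finset.sum_ite_eq' Finset.univ y, if_pos (Finset.mem_univ y), hNC y hy,
      zero_sub]
  have hLHS' : wExt * ∑ a ∈ Finset.univ.filter (· ∈ A), (rwZ E a y).toReal ≤
      ∑ u, (mass E u.1 - (graph E).degree u) * N u * (rwZ E u y).toReal := by
    calc wExt * ∑ a ∈ Finset.univ.filter (· ∈ A), (rwZ E a y).toReal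
        = ∑ a ∈ Finset.univ.filter (· ∈ A), wExt * (rwZ E a y).toReal := Finset.mul_sum _ _ _
      _ ≤ ∑ a ∈ Finset.univ.filter (· ∈ A), (mass E a.1 - (graph E).degree a) * N a * (rwZ E a y).toReal := by
          refine Finset.sum_le_sum fun a ha => ?_
          have ha' : a ∈ A := by simpa using ha
          rw [hNA a ha', mul_one]
          exact mul_le_mul_of_nonneg_right (wExt_le_mass_sub_degree hE (hAbd a ha')) (hZ0 a)
      _ ≤ ∑ u, (mass E u.1 - (graph E).degree u) * N u * (rwZ E u y).toReal :=
          Finset.sum_le_sum_of_subset_of_nonneg (Finset.subset_univ _) fun u _ _ =>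
            mul_nonneg (mul_nonneg (hκ0 u) (hN0 u)) (hZ0 u)
  -- the right-hand side
  have hRHS : ∑ c ∈ Finset.univ.filter (· ∈ C), (rwZ E c y).toReal * networkLaplacian (graph E) 1 N c ≤
      ∑ u, (rwZ E u y).toReal * networkLaplacian (graph E) 1 N u := by
    rw [← Finset.sum_filter_add_sum_filter_not Finset.univ (· ∈ C)]
    refine le_add_of_nonneg_right (Finset.sum_nonneg fun u hu => ?_)
    have huC : u ∉ C := by simpa using hu
    by_cases huA : u ∈ A
    · exact mul_nonneg (hZ0 u) (networkLaplacian_nonneg_of_eq_one (graph E) hN1 (hNA u huA))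
    · rw [hNW u huA huC, mul_zero]
  -- combine
  have hfin : ∑ c ∈ Finset.univ.filter (· ∈ C), (rwZ E c y).toReal * networkLaplacian (graph E) 1 N c ≤
      -(wExt * ∑ a ∈ Finset.univ.filter (· ∈ A), (rwZ E a y).toReal) := by
    have := hRHS.trans_eq (hgreen.symm.trans hLHS)
    linarith
  have hneg : ∑ c ∈ Finset.univ.filter (· ∈ C), (rwZ E c y).toReal * (-networkLaplacian (graph E) 1 N c) =
      -∑ c ∈ Finset.univ.filter (· ∈ C), (rwZ E c y).toReal * networkLaplacian (graph E) 1 N c := by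
    rw [← Finset.sum_neg_distrib]
    exact Finset.sum_congr rfl fun c _ => by ring
  rw [hneg]
  linarith

/-- **The RW partition function is bounded by the effective conductance** (CDH16 Thm. 3.9, second
assertion, in `Ω`; Chelkak 2016, Prop. 6.6, first display `Z_Ω([ab];[cd]) ≤ const · L_Ω([ab];[cd])⁻¹`): for a
connected discrete domain `Ω = ⟨E⟩` of `ℤ²` and any two sets `A, C ⊆ ∂Ω` of boundary vertices,
`Z_Ω[A,C] ≤ w_ext⁻² · 𝒞_Ω(A ↔ C)` with `𝒞 = 1/ℓ` the effective conductance of `Ω` with unit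
conductances (`w_ext⁻² = (3 + 2√2)/4`). Proof: for the harmonic interpolant `N` (`1` on `A`, `0` on `C`),
sum the Green pairing over the poles `y ∈ C`, bound `Σ_{y ∈ C} Z_Ω[c,y] ≤ w_ext⁻¹` (mass conservation)
and use `Σ_{c ∈ C} (−ΔN)(c) = Σ_{a ∈ A} ΔN(a) = 𝓔(N) = 𝒞(A ↔ C)` (Dirichlet's principle).
[cite: ChelkakDuminilCopinHongler2016, Thm. 3.9; Chelkak2016, Prop. 6.6] -/
theorem rwZSets_le_inv_wExt_sq_mul_effectiveConductance (hE : ∀ e ∈ E, e ∈ (zdGraph 2).edgeSet)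
    (hconn : (graph E).Preconnected) {A C : Set ↥((verts E : Finset (Site 2)) : Set (Site 2))} (hAbd : ∀ x ∈ A, x.1 ∈ bdVerts E)
    (hCbd : ∀ x ∈ C, x.1 ∈ bdVerts E) :
    rwZSets E A C ≤ ENNReal.ofReal (wExt ^ 2)⁻¹ * effectiveConductance (graph E) 1 A C := by
  have hw := wExt_pos
  by_cases hAC : Disjoint A C
  swap
  · rw [effectiveConductance_of_not_disjoint hAC, ENNReal.mul_top (ENNReal.ofReal_pos.2 (by positivity)).ne']
    exact le_top
  by_cases hA : A.Nonempty
  swap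
  · rw [Set.not_nonempty_iff_eq_empty] at hA
    subst hA
    simp [rwZSets]
  obtain ⟨N, hNA, hNC, hNW⟩ := exists_harmonic_interpolant (graph E) 1 hconn (one_conductance_pos _) hAC
  -- `0 ≤ N ≤ 1` by the maximum principle
  have hS : (A ∪ C).Nonempty := hA.mono Set.subset_union_left
  have hNS : ∀ z ∉ A ∪ C, networkLaplacian (graph E) 1 N z = 0 := fun z hz =>
    hNW z (fun h => hz (Or.inl h)) (fun h => hz (Or.inr h))
  have hbd : ∀ s ∈ A ∪ C, 0 ≤ N s ∧ N s ≤ 1 := by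
    rintro s (h | h)
    · rw [hNA s h]; exact ⟨zero_le_one, le_rfl⟩
    · rw [hNC s h]; exact ⟨le_rfl, zero_le_one⟩
  have hN1 : ∀ z, N z ≤ 1 := le_of_networkLaplacian_eq_zero_off (graph E) 1 hconn (one_conductance_pos _)
    hS hNS (fun s hs => (hbd s hs).2)
  have hN0 : ∀ z, 0 ≤ N z := ge_of_networkLaplacian_eq_zero_off (graph E) 1 hconn (one_conductance_pos _)
    hS hNS (fun s hs => (hbd s hs).1)
  -- the effective conductance is the current out of `A` = the current into `C`
  set e : ℝ := ∑ a ∈ Finset.univ.filter (· ∈ A), networkLaplacian (graph E) 1 N a with he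
  have hCeff : effectiveConductance (graph E) 1 A C = ENNReal.ofReal e := by
    rw [effectiveConductance_eq_networkEnergy_of_harmonic (graph E) 1 N hNA hNC hNW, networkEnergy_eq_ofReal_sum,
      energy_harmonic_eq_sum_filter (graph E) 1 N hNA hNC hNW]
  have hsumC : ∑ c ∈ Finset.univ.filter (· ∈ C), (-networkLaplacian (graph E) 1 N c) = e := by
    have h0 := sum_networkLaplacian (graph E) 1 N
    rw [← Finset.sum_filter_add_sum_filter_not Finset.univ (· ∈ A),
      ← Finset.sum_filter_add_sum_filter_not (Finset.univ.filter (fun z : ↥((verts E : Finset (Site 2)) : Set (Site 2)) => z ∉ A)) (· ∈ C)] at h0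
    have h1 : (Finset.univ.filter (fun z : ↥((verts E : Finset (Site 2)) : Set (Site 2)) => z ∉ A)).filter (· ∈ C) = Finset.univ.filter (· ∈ C) := by
      ext z
      simp only [Finset.mem_filter, Finset.mem_univ, true_and]
      exact ⟨And.right, fun hz => ⟨fun hzA => hAC.ne_of_mem hzA hz rfl, hz⟩⟩
    have h2 : ∑ z ∈ (Finset.univ.filter (fun z : ↥((verts E : Finset (Site 2)) : Set (Site 2)) => z ∉ A)).filter (fun z => z ∉ C),
        networkLaplacian (graph E) 1 N z = 0 := by
      refine Finset.sum_eq_zero fun z hz => ?_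
      simp only [Finset.mem_filter, Finset.mem_univ, true_and] at hz
      exact hNW z hz.1 hz.2
    rw [h1, h2, add_zero] at h0
    rw [Finset.sum_neg_distrib]
    linarith
  have he0 : 0 ≤ e := by
    rw [← hsumC]
    exact Finset.sum_nonneg fun c hc => neg_nonneg.2
      (networkLaplacian_nonpos_of_eq_zero (graph E) hN0 (hNC c (by simpa using hc)))
  -- the real inequality
  have hreal : ∑ a ∈ Finset.univ.filter (· ∈ A), ∑ y ∈ Finset.univ.filter (· ∈ C), (rwZ E a y).toReal ≤
      (wExt ^ 2)⁻¹ * e := by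
    set S := ∑ a ∈ Finset.univ.filter (· ∈ A), ∑ y ∈ Finset.univ.filter (· ∈ C), (rwZ E a y).toReal with hSdef
    have h1 : wExt * S = ∑ y ∈ Finset.univ.filter (· ∈ C), wExt * ∑ a ∈ Finset.univ.filter (· ∈ A), (rwZ E a y).toReal := by
      rw [hSdef, Finset.sum_comm, Finset.mul_sum]
    have h2 : ∑ y ∈ Finset.univ.filter (· ∈ C), wExt * ∑ a ∈ Finset.univ.filter (· ∈ A), (rwZ E a y).toReal ≤
        ∑ y ∈ Finset.univ.filter (· ∈ C), ∑ c ∈ Finset.univ.filter (· ∈ C),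
          (rwZ E c y).toReal * (-networkLaplacian (graph E) 1 N c) :=
      Finset.sum_le_sum fun y hy => wExt_mul_sum_toReal_rwZ_le hE hAbd hNA hNC hNW hN0 hN1 (by simpa using hy)
    have h3 : ∑ y ∈ Finset.univ.filter (· ∈ C), ∑ c ∈ Finset.univ.filter (· ∈ C),
          (rwZ E c y).toReal * (-networkLaplacian (graph E) 1 N c) =
        ∑ c ∈ Finset.univ.filter (· ∈ C), (-networkLaplacian (graph E) 1 N c) *
          ∑ y ∈ Finset.univ.filter (· ∈ C), (rwZ E c y).toReal := by
      rw [Finset.sum_comm]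
      refine Finset.sum_congr rfl fun c _ => ?_
      rw [Finset.mul_sum]
      exact Finset.sum_congr rfl fun y _ => mul_comm _ _
    have h4 : ∑ c ∈ Finset.univ.filter (· ∈ C), (-networkLaplacian (graph E) 1 N c) *
          ∑ y ∈ Finset.univ.filter (· ∈ C), (rwZ E c y).toReal ≤
        ∑ c ∈ Finset.univ.filter (· ∈ C), (-networkLaplacian (graph E) 1 N c) * wExt⁻¹ :=
      Finset.sum_le_sum fun c hc => mul_le_mul_of_nonneg_left
        (sum_toReal_rwZ_le_inv_wExt hE c fun y hy => hCbd y (by simpa using hy))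
        (neg_nonneg.2 (networkLaplacian_nonpos_of_eq_zero (graph E) hN0 (hNC c (by simpa using hc))))
    have h5 : ∑ c ∈ Finset.univ.filter (· ∈ C), (-networkLaplacian (graph E) 1 N c) * wExt⁻¹ = e * wExt⁻¹ := by
      rw [← Finset.sum_mul, hsumC]
    have h6 : wExt * S ≤ e * wExt⁻¹ := by linarith [h1.trans_le (h2.trans (h3.trans_le (h4.trans_eq h5)))]
    rw [show (wExt ^ 2)⁻¹ * e = (e * wExt⁻¹) * wExt⁻¹ by field_simp]
    rw [le_mul_inv_iff₀ hw]
    linarith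
  -- back to `ℝ≥0∞`
  rw [rwZSets_eq_sum, hCeff, ← ENNReal.ofReal_mul (by positivity)]
  calc ∑ a ∈ Finset.univ.filter (· ∈ A), ∑ y ∈ Finset.univ.filter (· ∈ C), rwZ E a y
      = ENNReal.ofReal (∑ a ∈ Finset.univ.filter (· ∈ A), ∑ y ∈ Finset.univ.filter (· ∈ C), (rwZ E a y).toReal) := by
        rw [ENNReal.ofReal_sum_of_nonneg (fun a _ => Finset.sum_nonneg fun y _ => ENNReal.toReal_nonneg)]
        refine Finset.sum_congr rfl fun a _ => ?_
        rw [ENNReal.ofReal_sum_of_nonneg (fun y _ => ENNReal.toReal_nonneg)]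
        exact Finset.sum_congr rfl fun y _ => (ENNReal.ofReal_toReal (rwZ_ne_top hE a y)).symm
    _ ≤ ENNReal.ofReal ((wExt ^ 2)⁻¹ * e) := ENNReal.ofReal_le_ofReal hreal

/-! ### Transfer to the network `⟨E⟩` on `ℤ²` and the statement for topological rectangles -/

/-- The energy of a potential of `ℤ²` on the network `⟨E⟩` (vertex type `Site 2`) dominates the energy of
its restriction to the vertex type of `Ω` (the two graphs have the same edges). [folklore] -/
theorem networkEnergy_graph_comp_le (v : Site 2 → ℝ) :
    networkEnergy (graph E) 1 (fun x : ↥((verts E : Finset (Site 2)) : Set (Site 2)) => v x.1) ≤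
      networkEnergy (SimpleGraph.fromEdgeSet (↑E : Set (Sym2 (Site 2)))) 1 v := by
  rw [networkEnergy_one_eq, networkEnergy_one_eq]
  refine le_trans (ENNReal.tsum_le_tsum fun e => ?_)
    (ENNReal.tsum_comp_le_tsum_of_injective (Sym2.map.injective Subtype.val_injective) _)
  induction e using Sym2.ind with
  | h x y =>
    by_cases hadj : (graph E).Adj x y
    · have h1 : s(x, y) ∈ (graph E).edgeSet := (mem_edgeSet _).2 hadj
      have h2 : Sym2.map Subtype.val s(x, y) ∈ (SimpleGraph.fromEdgeSet (↑E : Set (Sym2 (Site 2)))).edgeSet := by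
        rw [Sym2.map_mk, mem_edgeSet]
        exact hadj
      rw [Set.indicator_of_mem h1, Set.indicator_of_mem h2, Sym2.map_mk, sqIncr_mk, sqIncr_mk]
    · rw [Set.indicator_of_notMem ((mem_edgeSet _).not.2 hadj)]
      exact bot_le

/-- `𝒞_{graph E}(A ↔ C) ≤ 𝒞_{⟨E⟩}(A ↔ C)`: restricting an admissible potential of the network `⟨E⟩` on `ℤ²`
to the vertices of `Ω` gives an admissible potential of `graph E` with no larger energy. [folklore] -/
theorem effectiveConductance_graph_le (E : Finset (Sym2 (Site 2))) (A C : Set (Site 2)) :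
    effectiveConductance (graph E) 1 {x : ↥((verts E : Finset (Site 2)) : Set (Site 2)) | x.1 ∈ A} {x | x.1 ∈ C} ≤
      effectiveConductance (SimpleGraph.fromEdgeSet (↑E : Set (Sym2 (Site 2)))) 1 A C := by
  refine le_effectiveConductance fun v hvA hvC => ?_
  calc effectiveConductance (graph E) 1 {x : ↥((verts E : Finset (Site 2)) : Set (Site 2)) | x.1 ∈ A} {x | x.1 ∈ C}
      ≤ networkEnergy (graph E) 1 (fun x : ↥((verts E : Finset (Site 2)) : Set (Site 2)) => v x.1) :=
        effectiveConductance_le_networkEnergy (fun x hx => hvA hx) (fun x hx => hvC hx)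
    _ ≤ _ := networkEnergy_graph_comp_le v

/-- **`Z_Ω[A,C] · ℓ_Ω[A,C] ≤ w_ext⁻²`** for the network `⟨E⟩ ⊆ ℤ²` with unit conductances (the form of
`fkIsing_topologicalRectangle_crossingBounds`): for a connected discrete domain and `A, C ⊆ ∂Ω`,
`Z_Ω[A,C] ≤ w_ext⁻² · ℓ_Ω[A,C]⁻¹`. [cite: ChelkakDuminilCopinHongler2016, Thm. 3.9; Chelkak2016, Prop. 6.6] -/
theorem rwZSets_le_inv_wExt_sq_mul_inv_resistance (hE : ∀ e ∈ E, e ∈ (zdGraph 2).edgeSet)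
    (hconn : (graph E).Preconnected) {A C : Set (Site 2)} (hAbd : ∀ x ∈ A, x ∈ verts E → x ∈ bdVerts E)
    (hCbd : ∀ x ∈ C, x ∈ verts E → x ∈ bdVerts E) :
    rwZSets E {x : ↥((verts E : Finset (Site 2)) : Set (Site 2)) | x.1 ∈ A} {x | x.1 ∈ C} ≤ ENNReal.ofReal (wExt ^ 2)⁻¹ *
      (effectiveResistance (SimpleGraph.fromEdgeSet (↑E : Set (Sym2 (Site 2)))) 1 A C)⁻¹ := by
  rw [effectiveResistance_inv]
  calc rwZSets E {x : ↥((verts E : Finset (Site 2)) : Set (Site 2)) | x.1 ∈ A} {x | x.1 ∈ C}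
      ≤ ENNReal.ofReal (wExt ^ 2)⁻¹ * effectiveConductance (graph E) 1 {x : ↥((verts E : Finset (Site 2)) : Set (Site 2)) | x.1 ∈ A} {x | x.1 ∈ C} :=
        rwZSets_le_inv_wExt_sq_mul_effectiveConductance hE hconn (fun x hx => hAbd x.1 hx x.2)
          (fun x hx => hCbd x.1 hx x.2)
    _ ≤ _ := mul_le_mul' le_rfl (effectiveConductance_graph_le E A C)

/-- **CDH16 Theorem 3.9, second assertion, for a discrete topological rectangle** (Chelkak 2016,
Prop. 6.6): `Z_Ω[(ab),(cd)] ≤ w_ext⁻² / ℓ_Ω[(ab),(cd)]` for any two boundary arcs of `(Ω; a, b, c, d)` —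
uniformly in the domain. [cite: ChelkakDuminilCopinHongler2016, Thm. 3.9; Chelkak2016, Prop. 6.6] -/
theorem IsRect.rwZSets_arcVerts_le_inv_wExt_sq_mul_inv_resistance {d₀ : Site 2 × Fin 4} {n : Fin 4 → ℕ}
    (h : IsRect E d₀ n) (j j' : Fin 4) :
    rwZSets E {x : ↥((verts E : Finset (Site 2)) : Set (Site 2)) | x.1 ∈ arcVerts E d₀ n j} {x | x.1 ∈ arcVerts E d₀ n j'} ≤ ENNReal.ofReal (wExt ^ 2)⁻¹ *
      (effectiveResistance (SimpleGraph.fromEdgeSet (↑E : Set (Sym2 (Site 2)))) 1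
        (arcVerts E d₀ n j) (arcVerts E d₀ n j'))⁻¹ :=
  rwZSets_le_inv_wExt_sq_mul_inv_resistance h.subset_edgeSet h.preconnected
    (fun _ hx _ => arcVerts_subset_bdVerts h.isExtDart j hx) (fun _ hx _ => arcVerts_subset_bdVerts h.isExtDart j' hx)

/-- **CDH16 Theorem 3.9, second assertion** ("if `ℓ ≥ L` then `Z_Ω[(ab),(cd)] ≤ ζ₂(L)`", with
`ζ₂(L) → 0` as `L → ∞`), in `Ω` with the explicit decreasing function `ζ₂(L) = w_ext⁻² L⁻¹ = (3 + 2√2)/(4L)`: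
for every discrete topological rectangle, if `ℓ_Ω[(ab),(cd)] ≥ L > 0` then `Z_Ω[(ab),(cd)] ≤ (w_ext² L)⁻¹`
(Chelkak 2016, Prop. 6.6). This is the direction of Thm. 3.9 used in CDH16 §4.3 to enter the separator regime
(`ℓ ≥ L₀ ⇒ Z ≤ ζ₀'`); the converse direction (`ℓ ≤ L ⇒ Z ≥ ζ₁(L)`) is the deep part of Chelkak's toolbox.
[cite: ChelkakDuminilCopinHongler2016, Thm. 3.9; Chelkak2016, Prop. 6.6] -/
theorem IsRect.rwZSets_arcVerts_le_of_le_resistance {d₀ : Site 2 × Fin 4} {n : Fin 4 → ℕ}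
    (h : IsRect E d₀ n) (j j' : Fin 4) {L : ℝ} (hL : 0 < L)
    (hℓ : ENNReal.ofReal L ≤ effectiveResistance (SimpleGraph.fromEdgeSet (↑E : Set (Sym2 (Site 2)))) 1
      (arcVerts E d₀ n j) (arcVerts E d₀ n j')) :
    rwZSets E {x : ↥((verts E : Finset (Site 2)) : Set (Site 2)) | x.1 ∈ arcVerts E d₀ n j} {x | x.1 ∈ arcVerts E d₀ n j'} ≤
      ENNReal.ofReal (wExt ^ 2 * L)⁻¹ := by
  have hw := wExt_pos
  calc rwZSets E {x : ↥((verts E : Finset (Site 2)) : Set (Site 2)) | x.1 ∈ arcVerts E d₀ n j} {x | x.1 ∈ arcVerts E d₀ n j'}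
      ≤ ENNReal.ofReal (wExt ^ 2)⁻¹ * (effectiveResistance (SimpleGraph.fromEdgeSet (↑E : Set (Sym2 (Site 2)))) 1
          (arcVerts E d₀ n j) (arcVerts E d₀ n j'))⁻¹ := h.rwZSets_arcVerts_le_inv_wExt_sq_mul_inv_resistance j j'
    _ ≤ ENNReal.ofReal (wExt ^ 2)⁻¹ * (ENNReal.ofReal L)⁻¹ := mul_le_mul' le_rfl (ENNReal.inv_le_inv.2 hℓ)
    _ = ENNReal.ofReal (wExt ^ 2 * L)⁻¹ := by
        rw [← ENNReal.ofReal_inv_of_pos hL, ← ENNReal.ofReal_mul (by positivity), mul_inv]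

end DiscreteRect

end MainBound

/-! ### The penalised (Robin-type) interpolant of a finite network -/

section Penalised

variable {V : Type*} [Fintype V] [DecidableEq V] (G : SimpleGraph V) [DecidableRel G.Adj]

/-- **Existence of the penalised interpolant**: on a finite connected network with unit conductances and
nonnegative vertex weights `α, γ`, the equation `ΔN(u) + (α_u + γ_u) N(u) = α_u` (the Euler–Lagrange
equation of `𝓔(f) + Σ α (1 - f)² + Σ γ f²`, i.e. the Dirichlet problem of the network with pendant unit
edges of multiplicities `α` to a vertex held at `1` and `γ` to a vertex held at `0`, after elimination of
the pendant vertices) has a solution (the operator `Δ + diag(α + γ)` is injective by the energy identity,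
hence surjective; Lyons–Peres 2016, §2.1). [cite: LyonsPeres2016, §2.1, Existence and Uniqueness Principles] -/
theorem exists_penalised_interpolant (hG : G.Preconnected) {α γ : V → ℝ} (hα : ∀ u, 0 ≤ α u)
    (hγ : ∀ u, 0 ≤ γ u) :
    ∃ N : V → ℝ, ∀ u, networkLaplacian G 1 N u + (α u + γ u) * N u = α u := by
  classical
  by_cases hS : ∃ s, 0 < α s + γ s
  swap
  · push Not at hS
    refine ⟨fun _ ↦ 0, fun u ↦ ?_⟩
    have hαu : α u = 0 := by linarith [hS u, hα u, hγ u]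
    rw [networkLaplacian_zero, hαu, mul_zero, add_zero]
  obtain ⟨s, hs⟩ := hS
  let M : (V → ℝ) →ₗ[ℝ] (V → ℝ) :=
    { toFun := fun f u ↦ networkLaplacian G 1 f u + (α u + γ u) * f u
      map_add' := fun f g ↦ by
        funext u
        change networkLaplacian G 1 (fun y ↦ f y + g y) u + (α u + γ u) * (f u + g u) =
          (networkLaplacian G 1 f u + (α u + γ u) * f u) + (networkLaplacian G 1 g u + (α u + γ u) * g u)
        rw [networkLaplacian_add]
        ring
      map_smul' := fun t f ↦ by
        funext u
        change networkLaplacian G 1 (fun y ↦ t * f y) u + (α u + γ u) * (t * f u) =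
          t * (networkLaplacian G 1 f u + (α u + γ u) * f u)
        rw [networkLaplacian_smul]
        ring }
  have hM : ∀ f u, M f u = networkLaplacian G 1 f u + (α u + γ u) * f u := fun f u ↦ rfl
  have hinj : Function.Injective M := by
    refine (injective_iff_map_eq_zero M).2 fun f hf ↦ ?_
    have hfz : ∀ u, networkLaplacian G 1 f u + (α u + γ u) * f u = 0 := fun u ↦ by
      rw [← hM, hf]; rfl
    have h1 : 0 ≤ ∑ e ∈ G.edgeFinset, ((1 : Sym2 V → ℝ≥0) e : ℝ) * sqIncr f e :=
      Finset.sum_nonneg fun e _ ↦ mul_nonneg (NNReal.coe_nonneg _) (sqIncr_nonneg f e)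
    have h2 : 0 ≤ ∑ u, (α u + γ u) * f u ^ 2 :=
      Finset.sum_nonneg fun u _ ↦ mul_nonneg (add_nonneg (hα u) (hγ u)) (sq_nonneg _)
    have hE : ∑ e ∈ G.edgeFinset, ((1 : Sym2 V → ℝ≥0) e : ℝ) * sqIncr f e + ∑ u, (α u + γ u) * f u ^ 2 = 0 := by
      rw [← sum_mul_networkLaplacian_self, ← Finset.sum_add_distrib]
      refine Finset.sum_eq_zero fun u _ ↦ ?_
      calc f u * networkLaplacian G 1 f u + (α u + γ u) * f u ^ 2
          = f u * (networkLaplacian G 1 f u + (α u + γ u) * f u) := by ring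
        _ = 0 := by rw [hfz u, mul_zero]
    have hE1 : ∑ e ∈ G.edgeFinset, ((1 : Sym2 V → ℝ≥0) e : ℝ) * sqIncr f e = 0 := by linarith
    have hE2 : ∑ u, (α u + γ u) * f u ^ 2 = 0 := by linarith
    have hstep : ∀ (x y : V) (p : G.Walk x y), f x = f y := by
      intro x y p
      induction p with
      | nil => rfl
      | cons hadj _ ih => exact (eq_of_energy_eq_zero G 1 hE1 ⟨hadj, zero_lt_one⟩).trans ih
    have hfs : f s = 0 := by
      have h := (Finset.sum_eq_zero_iff_of_nonneg (fun u _ ↦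
        mul_nonneg (add_nonneg (hα u) (hγ u)) (sq_nonneg (f u)))).1 hE2 s (Finset.mem_univ _)
      rcases mul_eq_zero.1 h with h | h
      · exact absurd h hs.ne'
      · exact (pow_eq_zero_iff two_ne_zero).1 h
    funext u
    obtain ⟨p⟩ := hG u s
    rw [hstep u s p, hfs]
    rfl
  obtain ⟨N, hN⟩ := LinearMap.injective_iff_surjective.1 hinj α
  exact ⟨N, fun u ↦ by rw [← hM, hN]⟩

omit [DecidableEq V] in
/-- **Maximum principle for the penalised equation**: a solution of `ΔN + (α + γ) N = α` with `α, γ ≥ 0`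
not both identically zero satisfies `N ≤ 1` (at a maximum vertex `ΔN ≥ 0`, while the equation gives
`ΔN = α(1 - N) - γN < 0` where `N > 1` and `α + γ > 0`; propagate along a path otherwise).
[cite: LyonsPeres2016, §2.1, Maximum Principle] -/
theorem penalised_le_one (hG : G.Preconnected) {α γ : V → ℝ} (hα : ∀ u, 0 ≤ α u) (hγ : ∀ u, 0 ≤ γ u)
    (hS : ∃ s, 0 < α s + γ s) {N : V → ℝ} (hN : ∀ u, networkLaplacian G 1 N u + (α u + γ u) * N u = α u)
    (z : V) : N z ≤ 1 := by
  classical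
  obtain ⟨s, hs⟩ := hS
  obtain ⟨z₀, -, hz₀⟩ := exists_max_image (univ : Finset V) N ⟨s, mem_univ _⟩
  by_contra hcon
  have hmax : 1 < N z₀ := (not_le.1 hcon).trans_le (hz₀ z (mem_univ _))
  -- at a vertex where the maximum is attained: `α + γ = 0` and all neighbours attain the maximum
  have P : ∀ x, N x = N z₀ → α x + γ x = 0 ∧ ∀ w, G.Adj x w → N w = N z₀ := by
    intro x hx
    have hterm : ∀ w ∈ (univ : Finset V),
        0 ≤ (if G.Adj x w then ((1 : Sym2 V → ℝ≥0) s(x, w) : ℝ) * (N x - N w) else 0) := by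
      intro w _
      split_ifs
      · simp only [Pi.one_apply, NNReal.coe_one, one_mul, sub_nonneg]
        rw [hx]
        exact hz₀ w (mem_univ _)
      · exact le_rfl
    have hL0 : 0 ≤ networkLaplacian G 1 N x := by
      rw [networkLaplacian_apply]
      exact Finset.sum_nonneg hterm
    have hNx : 1 < N x := by rw [hx]; exact hmax
    have heq := hN x
    have h1 : α x * (1 - N x) ≤ 0 := mul_nonpos_of_nonneg_of_nonpos (hα x) (by linarith)
    have h2 : 0 ≤ γ x * N x := mul_nonneg (hγ x) (by linarith)
    have hLle : networkLaplacian G 1 N x ≤ 0 := by nlinarith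
    have hL : networkLaplacian G 1 N x = 0 := le_antisymm hLle hL0
    refine ⟨?_, fun w hw ↦ ?_⟩
    · have hαx : α x = 0 := by
        by_contra hne
        have : 0 < α x := lt_of_le_of_ne (hα x) (Ne.symm hne)
        nlinarith
      have hγx : γ x = 0 := by
        by_contra hne
        have : 0 < γ x := lt_of_le_of_ne (hγ x) (Ne.symm hne)
        nlinarith
      rw [hαx, hγx, add_zero]
    · rw [networkLaplacian_apply] at hL
      have h0 := (Finset.sum_eq_zero_iff_of_nonneg hterm).1 hL w (mem_univ _)
      rw [if_pos hw] at h0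
      simp only [Pi.one_apply, NNReal.coe_one, one_mul] at h0
      linarith [sub_eq_zero.1 h0]
  have key : ∀ (x y : V) (p : G.Walk x y), N x = N z₀ → N y = N z₀ := by
    intro x y p
    induction p with
    | nil => exact id
    | cons hadj _ ih => exact fun hx ↦ ih ((P _ hx).2 _ hadj)
  obtain ⟨p⟩ := hG z₀ s
  have h := (P s (key z₀ s p rfl)).1
  linarith

omit [DecidableEq V] in
/-- **Minimum principle for the penalised equation**: `0 ≤ N` (the maximum principle for `1 - N`, which
solves the same equation with `α` and `γ` exchanged). [cite: LyonsPeres2016, §2.1, Maximum Principle] -/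
theorem penalised_nonneg (hG : G.Preconnected) {α γ : V → ℝ} (hα : ∀ u, 0 ≤ α u) (hγ : ∀ u, 0 ≤ γ u)
    (hS : ∃ s, 0 < α s + γ s) {N : V → ℝ} (hN : ∀ u, networkLaplacian G 1 N u + (α u + γ u) * N u = α u)
    (z : V) : 0 ≤ N z := by
  have hfun : (fun u ↦ 1 - N u) = fun u ↦ (-1) * N u - (-1) := by funext u; ring
  have hN' : ∀ u, networkLaplacian G 1 (fun u ↦ 1 - N u) u + (γ u + α u) * (1 - N u) = γ u := by
    intro u
    rw [hfun, networkLaplacian_sub_const, networkLaplacian_smul]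
    have := hN u
    linarith
  obtain ⟨s, hs⟩ := hS
  have h := penalised_le_one G hG hγ hα ⟨s, by linarith⟩ hN' z
  linarith

/-- **The penalised Dirichlet principle**: the solution `N` of `ΔN + (α + γ)N = α` minimises
`Q(f) = 𝓔(f) + Σ_u α_u (1 - f(u))² + Σ_u γ_u f(u)²`, since `Q(f) = Q(N) + 𝓔(f - N) + Σ (α + γ)(f - N)²`
(Lyons–Peres 2016, Exercise 2.13, for the network with pendant edges). [cite: LyonsPeres2016, §2.4, Exercise 2.13] -/
theorem penalised_energy_le {α γ : V → ℝ} (hα : ∀ u, 0 ≤ α u) (hγ : ∀ u, 0 ≤ γ u) {N : V → ℝ}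
    (hN : ∀ u, networkLaplacian G 1 N u + (α u + γ u) * N u = α u) (f : V → ℝ) :
    ∑ e ∈ G.edgeFinset, ((1 : Sym2 V → ℝ≥0) e : ℝ) * sqIncr N e + ∑ u, (α u * (1 - N u) ^ 2 + γ u * N u ^ 2) ≤
      ∑ e ∈ G.edgeFinset, ((1 : Sym2 V → ℝ≥0) e : ℝ) * sqIncr f e + ∑ u, (α u * (1 - f u) ^ 2 + γ u * f u ^ 2) := by
  set E : (V → ℝ) → ℝ := fun v ↦ ∑ e ∈ G.edgeFinset, ((1 : Sym2 V → ℝ≥0) e : ℝ) * sqIncr v e with hE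
  have hcross : ∑ e ∈ G.edgeFinset, ((1 : Sym2 V → ℝ≥0) e : ℝ) *
      Sym2.lift ⟨fun a b ↦ ((f a - N a) - (f b - N b)) * (N a - N b), fun a b ↦ by ring⟩ e
        = ∑ z, (f z - N z) * networkLaplacian G 1 N z := by
    rw [sum_edgeFinset_mul_incr G 1 (fun z ↦ f z - N z) N]
    rfl
  have hsplit : E f = E N + 2 * ∑ e ∈ G.edgeFinset, ((1 : Sym2 V → ℝ≥0) e : ℝ) *
      Sym2.lift ⟨fun a b ↦ ((f a - N a) - (f b - N b)) * (N a - N b), fun a b ↦ by ring⟩ e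
        + E (fun z ↦ f z - N z) := by
    simp only [hE, mul_sum, ← sum_add_distrib]
    refine sum_congr rfl fun e _ ↦ ?_
    rw [sqIncr_eq_sqIncr_add f N e]
    ring
  have hnonneg : 0 ≤ E (fun z ↦ f z - N z) :=
    sum_nonneg fun e _ ↦ mul_nonneg (NNReal.coe_nonneg _) (sqIncr_nonneg _ e)
  have hpen : ∑ u, (α u * (1 - f u) ^ 2 + γ u * f u ^ 2) =
      ∑ u, (α u * (1 - N u) ^ 2 + γ u * N u ^ 2) +
        ∑ u, (2 * (f u - N u) * (-(α u * (1 - N u)) + γ u * N u) + (α u + γ u) * (f u - N u) ^ 2) := by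
    rw [← Finset.sum_add_distrib]
    exact Finset.sum_congr rfl fun u _ ↦ by ring
  have hzero : ∑ z, (f z - N z) * networkLaplacian G 1 N z +
      ∑ u, (f u - N u) * (-(α u * (1 - N u)) + γ u * N u) = 0 := by
    rw [← Finset.sum_add_distrib]
    refine Finset.sum_eq_zero fun u _ ↦ ?_
    have := hN u
    calc (f u - N u) * networkLaplacian G 1 N u + (f u - N u) * (-(α u * (1 - N u)) + γ u * N u)
        = (f u - N u) * (networkLaplacian G 1 N u + (α u + γ u) * N u - α u) := by ring
      _ = 0 := by rw [this, sub_self, mul_zero]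
  have hpos2 : 0 ≤ ∑ u, (α u + γ u) * (f u - N u) ^ 2 :=
    Finset.sum_nonneg fun u _ ↦ mul_nonneg (add_nonneg (hα u) (hγ u)) (sq_nonneg _)
  have hsum2 : ∑ u, (2 * (f u - N u) * (-(α u * (1 - N u)) + γ u * N u) + (α u + γ u) * (f u - N u) ^ 2) =
      2 * ∑ u, (f u - N u) * (-(α u * (1 - N u)) + γ u * N u) + ∑ u, (α u + γ u) * (f u - N u) ^ 2 := by
    rw [Finset.mul_sum, ← Finset.sum_add_distrib]
    exact Finset.sum_congr rfl fun u _ ↦ by ring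
  change E N + _ ≤ E f + _
  rw [hsplit, hcross, hpen, hsum2]
  nlinarith

/-- The value of the penalised energy at its minimiser is the total current
`Q(N) = Σ_u α_u (1 - N(u))`. [cite: LyonsPeres2016, §2.4, Exercise 2.13] -/
theorem penalised_energy_eq {α γ : V → ℝ} {N : V → ℝ}
    (hN : ∀ u, networkLaplacian G 1 N u + (α u + γ u) * N u = α u) :
    ∑ e ∈ G.edgeFinset, ((1 : Sym2 V → ℝ≥0) e : ℝ) * sqIncr N e + ∑ u, (α u * (1 - N u) ^ 2 + γ u * N u ^ 2) =
      ∑ u, α u * (1 - N u) := by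
  rw [← sum_mul_networkLaplacian_self, ← Finset.sum_add_distrib]
  refine Finset.sum_congr rfl fun u _ ↦ ?_
  have := hN u
  have hL : networkLaplacian G 1 N u = α u - (α u + γ u) * N u := by linarith
  rw [hL]
  ring

/-- **Current conservation**: the current out of the `1`-terminal equals the current into the
`0`-terminal, `Σ_u α_u (1 - N(u)) = Σ_u γ_u N(u)` (the Laplacian sums to zero).
[cite: LyonsPeres2016, §2.4, Lemma 2.8] -/
theorem penalised_current_eq {α γ : V → ℝ} {N : V → ℝ}
    (hN : ∀ u, networkLaplacian G 1 N u + (α u + γ u) * N u = α u) :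
    ∑ u, α u * (1 - N u) = ∑ u, γ u * N u := by
  have h0 := sum_networkLaplacian G 1 N
  have h1 : ∑ u, networkLaplacian G 1 N u = ∑ u, (α u * (1 - N u) - γ u * N u) :=
    Finset.sum_congr rfl fun u _ ↦ by have := hN u; linarith
  rw [h1, Finset.sum_sub_distrib] at h0
  linarith

end Penalised

/-! ### The energy of `Ω̄` dominates the penalised energy of `Ω` -/

section ExtBound

namespace DiscreteRect

open scoped Classical

variable {E : Finset (Sym2 (Site 2))} {d₀ : Site 2 × Fin 4} {n : Fin 4 → ℕ}

/-- The arcs end before the period: `lo n j + n j ≤ N`. [folklore] -/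
theorem lo_add_le (n : Fin 4 → ℕ) (j : Fin 4) : lo n j + n j ≤ n 0 + n 1 + n 2 + n 3 := by
  fin_cases j <;> simp [lo] <;> omega

/-- Distinct arcs occupy disjoint position ranges. [folklore] -/
theorem Ico_lo_disjoint {j j' : Fin 4} (hjj' : j ≠ j') :
    Disjoint (Finset.Ico (lo n j) (lo n j + n j)) (Finset.Ico (lo n j') (lo n j' + n j')) := by
  rw [Finset.disjoint_left]
  intro i hi hi'
  simp only [Finset.mem_Ico] at hi hi'
  fin_cases j <;> fin_cases j' <;> simp [lo] at hi hi' hjj' <;> omega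

/-- **The energy of a potential of `Ω̄` dominates its inner energy plus the pendant terms of two arcs**:
`𝓔_Ω(F ∘ inl) + Σ_{i ∈ arc j ∪ arc j'} (F(x_i) - F(x_i^ext))² ≤ 𝓔_Ω̄(F)` (the inner edges and the pendant
edges of the darts at distinct positions of the boundary cycle are distinct edges of `Ω̄`). [folklore] -/
theorem IsRect.inner_add_pendant_le_networkEnergy_extGraph (h : IsRect E d₀ n) (j j' : Fin 4)
    (F : Site 2 ⊕ (Site 2 × Fin 4) → ℝ) :
    networkEnergy (graph E) 1 (fun x : ↥((verts E : Finset (Site 2)) : Set (Site 2)) ↦ F (.inl x.1)) +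
      ∑ i ∈ Finset.Ico (lo n j) (lo n j + n j) ∪ Finset.Ico (lo n j') (lo n j' + n j'),
        ENNReal.ofReal ((F (.inl ((succ E)^[i] d₀).1) - F (.inr ((succ E)^[i] d₀))) ^ 2)
      ≤ networkEnergy (extGraph E) 1 F := by
  set I := Finset.Ico (lo n j) (lo n j + n j) ∪ Finset.Ico (lo n j') (lo n j' + n j') with hI
  have hIN : ∀ i ∈ I, i < n 0 + n 1 + n 2 + n 3 := by
    intro i hi
    rcases Finset.mem_union.1 hi with hi | hi
    · have := lo_add_le n j
      rw [Finset.mem_Ico] at hi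
      omega
    · have := lo_add_le n j'
      rw [Finset.mem_Ico] at hi
      omega
  set g : Sym2 (Site 2 ⊕ (Site 2 × Fin 4)) → ℝ≥0∞ :=
    (extGraph E).edgeSet.indicator (fun e ↦ ENNReal.ofReal (sqIncr F e)) with hg
  set ι : Sym2 ↥((verts E : Finset (Site 2)) : Set (Site 2)) ⊕ ↥I → Sym2 (Site 2 ⊕ (Site 2 × Fin 4)) :=
    Sum.elim (Sym2.map (fun x ↦ Sum.inl x.1))
      (fun i ↦ s(.inl ((succ E)^[i.1] d₀).1, .inr ((succ E)^[i.1] d₀))) with hι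
  have hnot : ∀ (e : Sym2 ↥((verts E : Finset (Site 2)) : Set (Site 2))) (x : Site 2) (d : Site 2 × Fin 4),
      Sym2.map (fun x : ↥((verts E : Finset (Site 2)) : Set (Site 2)) ↦ (Sum.inl x.1 : Site 2 ⊕ (Site 2 × Fin 4))) e ≠
        s(.inl x, .inr d) := by
    intro e x d heq
    have hmem : (Sum.inr d : Site 2 ⊕ (Site 2 × Fin 4)) ∈
        Sym2.map (fun x : ↥((verts E : Finset (Site 2)) : Set (Site 2)) ↦ (Sum.inl x.1 : Site 2 ⊕ (Site 2 × Fin 4))) e := by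
      rw [heq]; exact Sym2.mem_mk_right _ _
    obtain ⟨w, -, hw⟩ := Sym2.mem_map.1 hmem
    exact Sum.inl_ne_inr hw
  have hιinj : Function.Injective ι := by
    rintro (e | i) (e' | i') heq
    · simp only [hι, Sum.elim_inl] at heq
      have hinj : Function.Injective (fun x : ↥((verts E : Finset (Site 2)) : Set (Site 2)) ↦
          (Sum.inl x.1 : Site 2 ⊕ (Site 2 × Fin 4))) :=
        fun x y hxy ↦ Subtype.ext (Sum.inl_injective hxy)
      exact congrArg Sum.inl (Sym2.map.injective hinj heq)
    · exact absurd heq (hnot e _ _)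
    · exact absurd heq.symm (hnot e' _ _)
    · simp only [hι, Sum.elim_inr] at heq
      have hd : (succ E)^[i.1] d₀ = (succ E)^[i'.1] d₀ := by
        rcases Sym2.eq_iff.1 heq with ⟨-, h2⟩ | ⟨h1, -⟩
        · exact Sum.inr_injective h2
        · exact absurd h1 Sum.inl_ne_inr
      have := h.injOn i.1 i'.1 (hIN _ i.2) (hIN _ i'.2) hd
      exact congrArg Sum.inr (Subtype.ext this)
  have hinner : networkEnergy (graph E) 1 (fun x : ↥((verts E : Finset (Site 2)) : Set (Site 2)) ↦ F (.inl x.1)) ≤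
      ∑' e, g (ι (Sum.inl e)) := by
    rw [networkEnergy_one_eq]
    refine ENNReal.tsum_le_tsum fun e ↦ ?_
    induction e using Sym2.ind with
    | h x y =>
      by_cases hadj : (graph E).Adj x y
      · have hadj' : (extGraph E).Adj (.inl x.1) (.inl y.1) :=
          extGraph_adj_inl_inl.2 ⟨(graph_adj_iff.1 hadj).2, (graph_adj_iff.1 hadj).1⟩
        simp only [hι, Sum.elim_inl, Sym2.map_mk, hg]
        rw [Set.indicator_of_mem ((mem_edgeSet _).2 hadj), Set.indicator_of_mem ((mem_edgeSet _).2 hadj'),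
          sqIncr_mk, sqIncr_mk]
      · rw [Set.indicator_of_notMem ((mem_edgeSet _).not.2 hadj)]
        exact bot_le
  have hpend : ∑ i ∈ I, ENNReal.ofReal ((F (.inl ((succ E)^[i] d₀).1) - F (.inr ((succ E)^[i] d₀))) ^ 2) =
      ∑' i : ↥I, g (ι (Sum.inr i)) := by
    have hterm : ∀ i : ℕ, g (s(.inl ((succ E)^[i] d₀).1, .inr ((succ E)^[i] d₀))) =
        ENNReal.ofReal ((F (.inl ((succ E)^[i] d₀).1) - F (.inr ((succ E)^[i] d₀))) ^ 2) := by
      intro i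
      have hadj : (extGraph E).Adj (.inl ((succ E)^[i] d₀).1) (.inr ((succ E)^[i] d₀)) :=
        extGraph_adj_inl_inr.2 ⟨h.isExtDart.iterate i, rfl⟩
      rw [hg, Set.indicator_of_mem ((mem_edgeSet _).2 hadj), sqIncr_mk]
    simp only [hι, Sum.elim_inr]
    rw [Finset.tsum_subtype I (fun i ↦ g (s(.inl ((succ E)^[i] d₀).1, .inr ((succ E)^[i] d₀))))]
    exact Finset.sum_congr rfl fun i _ ↦ (hterm i).symm
  calc networkEnergy (graph E) 1 (fun x : ↥((verts E : Finset (Site 2)) : Set (Site 2)) ↦ F (.inl x.1)) +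
        ∑ i ∈ I, ENNReal.ofReal ((F (.inl ((succ E)^[i] d₀).1) - F (.inr ((succ E)^[i] d₀))) ^ 2)
      ≤ ∑' e, g (ι (Sum.inl e)) + ∑' i : ↥I, g (ι (Sum.inr i)) := by rw [hpend]; exact add_le_add hinner le_rfl
    _ = ∑' t, g (ι t) := (Summable.tsum_sum (f := fun t ↦ g (ι t)) ENNReal.summable ENNReal.summable).symm
    _ ≤ ∑' u, g u := ENNReal.tsum_comp_le_tsum_of_injective hιinj g
    _ = networkEnergy (extGraph E) 1 F := (networkEnergy_one_eq _ _).symm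

/-- **The RW partition function is bounded by the conductance of `Ω̄` between external arcs** (CDH16
Thm. 3.9, second assertion, with the printed hypothesis on `ℓ_Ω̄`; Chelkak 2016, Prop. 6.6): for every discrete
topological rectangle and any two of its arcs,
`Z_Ω[(arc j),(arc j')] ≤ ((1 + w_ext)/w_ext²) · ℓ_Ω̄[(arc j)_ext,(arc j')_ext]⁻¹`.
Proof: the penalised interpolant `N` of `Ω` (`ΔN + (α+γ)N = α`, `α_u, γ_u` = number of darts of the arcs
`j, j'` based at `u` — the elimination of the pendant vertices of `Ω̄` held at `1` on `(arc j)_ext` and at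
`0` on `(arc j')_ext`) has values in `[0,1]` and current `I = Σ α(1-N) = Σ γN ≤ 𝒞_Ω̄` (penalised Dirichlet
principle and the domination of the penalised energy by the energy of `Ω̄`); the Green pairing of `N`
with `Z_Ω[·,y]` gives `w_ext Σ_{a ∈ arc j} Z_Ω[a,y] ≤ N(y) + Σ_u γ_u N(u) Z_Ω[u,y]`, and summing over
`y ∈ arc j'` with `Σ_{y} Z_Ω[u,y] ≤ w_ext⁻¹` yields `w_ext Z ≤ (1 + w_ext⁻¹) I`.
[cite: ChelkakDuminilCopinHongler2016, Thm. 3.9; Chelkak2016, Prop. 6.6] -/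
theorem IsRect.rwZSets_arcVerts_le_mul_inv_extResistance (h : IsRect E d₀ n) (j j' : Fin 4) :
    rwZSets E {x : ↥((verts E : Finset (Site 2)) : Set (Site 2)) | x.1 ∈ arcVerts E d₀ n j}
        {x | x.1 ∈ arcVerts E d₀ n j'} ≤
      ENNReal.ofReal ((1 + wExt) / wExt ^ 2) * (extResistance E d₀ n j j')⁻¹ := by
  have hw := wExt_pos
  have hw1 := wExt_lt_one
  have hE := h.subset_edgeSet
  -- the case `j = j'`: the external arcs meet, `ℓ_Ω̄ = 0`
  rcases eq_or_ne j j' with rfl | hjj'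
  · have hne : ¬ Disjoint (extArc E d₀ n j) (extArc E d₀ n j) := by
      rw [Set.disjoint_iff_inter_eq_empty, Set.inter_self]
      exact Set.Nonempty.ne_empty ⟨.inr ((succ E)^[lo n j] d₀), lo n j, le_rfl, by have := h.pos j; omega, rfl⟩
    rw [extResistance, effectiveResistance_of_not_disjoint hne, ENNReal.inv_zero,
      ENNReal.mul_top (ENNReal.ofReal_pos.2 (by positivity)).ne']
    exact le_top
  -- setup: positions, base vertices, multiplicities
  set Ij := Finset.Ico (lo n j) (lo n j + n j) with hIj
  set Ij' := Finset.Ico (lo n j') (lo n j' + n j') with hIj'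
  set base : ℕ → ↥((verts E : Finset (Site 2)) : Set (Site 2)) :=
    fun i ↦ ⟨((succ E)^[i] d₀).1, (h.isExtDart.iterate i).1⟩ with hbase
  set α : ↥((verts E : Finset (Site 2)) : Set (Site 2)) → ℝ := fun u ↦ ((Ij.filter (fun i ↦ base i = u)).card : ℝ)
    with hαdef
  set γ : ↥((verts E : Finset (Site 2)) : Set (Site 2)) → ℝ := fun u ↦ ((Ij'.filter (fun i ↦ base i = u)).card : ℝ)
    with hγdef
  have hα0 : ∀ u, 0 ≤ α u := fun u ↦ Nat.cast_nonneg _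
  have hγ0 : ∀ u, 0 ≤ γ u := fun u ↦ Nat.cast_nonneg _
  have hαA : ∀ u : ↥((verts E : Finset (Site 2)) : Set (Site 2)), u.1 ∈ arcVerts E d₀ n j → 1 ≤ α u := by
    rintro u ⟨i, hi1, hi2, hiu⟩
    have hne : (Ij.filter (fun i ↦ base i = u)).Nonempty :=
      ⟨i, Finset.mem_filter.2 ⟨Finset.mem_Ico.2 ⟨hi1, hi2⟩, Subtype.ext hiu⟩⟩
    have h1 : 1 ≤ (Ij.filter (fun i ↦ base i = u)).card := Finset.card_pos.2 hne
    show (1 : ℝ) ≤ ((Ij.filter (fun i ↦ base i = u)).card : ℝ)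
    exact_mod_cast h1
  have hγC : ∀ u : ↥((verts E : Finset (Site 2)) : Set (Site 2)), u.1 ∈ arcVerts E d₀ n j' → 1 ≤ γ u := by
    rintro u ⟨i, hi1, hi2, hiu⟩
    have hne : (Ij'.filter (fun i ↦ base i = u)).Nonempty :=
      ⟨i, Finset.mem_filter.2 ⟨Finset.mem_Ico.2 ⟨hi1, hi2⟩, Subtype.ext hiu⟩⟩
    have h1 : 1 ≤ (Ij'.filter (fun i ↦ base i = u)).card := Finset.card_pos.2 hne
    show (1 : ℝ) ≤ ((Ij'.filter (fun i ↦ base i = u)).card : ℝ)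
    exact_mod_cast h1
  -- regrouping sums over positions by base vertex
  have hfib : ∀ (T : Finset ℕ) (φ : ↥((verts E : Finset (Site 2)) : Set (Site 2)) → ℝ),
      ∑ i ∈ T, φ (base i) = ∑ u, ((T.filter (fun i ↦ base i = u)).card : ℝ) * φ u := by
    intro T φ
    rw [← Finset.sum_fiberwise_of_maps_to (s := T) (t := Finset.univ) (g := base) (fun i _ ↦ Finset.mem_univ _)]
    refine Finset.sum_congr rfl fun u _ ↦ ?_
    rw [Finset.sum_congr rfl (fun i hi ↦ by rw [(Finset.mem_filter.1 hi).2]), Finset.sum_const, nsmul_eq_mul]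
  -- the penalised interpolant
  obtain ⟨a₀, ha₀⟩ := h.arcVerts_nonempty j
  have ha₀V : a₀ ∈ verts E := arcVerts_subset_verts h.isExtDart j ha₀
  have hS : ∃ s : ↥((verts E : Finset (Site 2)) : Set (Site 2)), 0 < α s + γ s :=
    ⟨⟨a₀, ha₀V⟩, by have := hαA ⟨a₀, ha₀V⟩ ha₀; linarith [hγ0 ⟨a₀, ha₀V⟩]⟩
  obtain ⟨N, hN⟩ := exists_penalised_interpolant (graph E) h.preconnected hα0 hγ0
  have hN1 := penalised_le_one (graph E) h.preconnected hα0 hγ0 hS hN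
  have hN0 := penalised_nonneg (graph E) h.preconnected hα0 hγ0 hS hN
  set I : ℝ := ∑ u, γ u * N u with hIdef
  have hI' : ∑ u, α u * (1 - N u) = I := penalised_current_eq (graph E) hN
  have hI0 : 0 ≤ I := Finset.sum_nonneg fun u _ ↦ mul_nonneg (hγ0 u) (hN0 u)
  -- (1) the Green pairing, one pole
  have key : ∀ y : ↥((verts E : Finset (Site 2)) : Set (Site 2)),
      wExt * ∑ a ∈ Finset.univ.filter (fun u : ↥((verts E : Finset (Site 2)) : Set (Site 2)) ↦ u.1 ∈ arcVerts E d₀ n j),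
        (rwZ E a y).toReal ≤ N y + ∑ u, γ u * N u * (rwZ E u y).toReal := by
    intro y
    have hZ0 : ∀ u, 0 ≤ (rwZ E u y).toReal := fun u ↦ ENNReal.toReal_nonneg
    have hκ0 : ∀ u : ↥((verts E : Finset (Site 2)) : Set (Site 2)), 0 ≤ mass E u.1 - (graph E).degree u :=
      fun u ↦ sub_nonneg.2 (degree_le_mass hE u)
    have hgreen : ∑ u, N u * networkLaplacian (graph E) 1 (fun u ↦ (rwZ E u y).toReal) u =
        ∑ u, (rwZ E u y).toReal * networkLaplacian (graph E) 1 N u :=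
      sum_mul_networkLaplacian_comm (graph E) 1 (fun u ↦ (rwZ E u y).toReal) N
    have hLHS : ∑ u, N u * networkLaplacian (graph E) 1 (fun u ↦ (rwZ E u y).toReal) u =
        N y - ∑ u, (mass E u.1 - (graph E).degree u) * N u * (rwZ E u y).toReal := by
      have h1 : ∀ u, N u * networkLaplacian (graph E) 1 (fun u ↦ (rwZ E u y).toReal) u =
          (if u = y then N u else 0) - (mass E u.1 - (graph E).degree u) * N u * (rwZ E u y).toReal := by
        intro u
        rw [networkLaplacian_toReal_rwZ hE u y]
        split_ifs <;> ring
      simp_rw [h1]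
      rw [Finset.sum_sub_distrib, Finset.sum_ite_eq' Finset.univ y, if_pos (Finset.mem_univ y)]
    have hRHS : ∑ u, (rwZ E u y).toReal * networkLaplacian (graph E) 1 N u =
        ∑ u, (rwZ E u y).toReal * (α u - (α u + γ u) * N u) :=
      Finset.sum_congr rfl fun u _ ↦ by rw [show networkLaplacian (graph E) 1 N u = α u - (α u + γ u) * N u by
        have := hN u; linarith]
    have hident : ∑ u, (rwZ E u y).toReal * ((mass E u.1 - (graph E).degree u) * N u + α u * (1 - N u)) =
        N y + ∑ u, γ u * N u * (rwZ E u y).toReal := by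
      have hsplit : ∑ u, (rwZ E u y).toReal * ((mass E u.1 - (graph E).degree u) * N u + α u * (1 - N u)) =
          ∑ u, (mass E u.1 - (graph E).degree u) * N u * (rwZ E u y).toReal +
            ∑ u, (rwZ E u y).toReal * (α u - (α u + γ u) * N u) + ∑ u, γ u * N u * (rwZ E u y).toReal := by
        rw [← Finset.sum_add_distrib, ← Finset.sum_add_distrib]
        exact Finset.sum_congr rfl fun u _ ↦ by ring
      rw [hsplit, ← hRHS, ← hgreen, hLHS]
      ring
    have hlow : wExt * ∑ a ∈ Finset.univ.filter (fun u : ↥((verts E : Finset (Site 2)) : Set (Site 2)) ↦ u.1 ∈ arcVerts E d₀ n j),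
        (rwZ E a y).toReal ≤ ∑ u, (rwZ E u y).toReal * ((mass E u.1 - (graph E).degree u) * N u + α u * (1 - N u)) := by
      rw [Finset.mul_sum]
      calc ∑ a ∈ Finset.univ.filter (fun u : ↥((verts E : Finset (Site 2)) : Set (Site 2)) ↦ u.1 ∈ arcVerts E d₀ n j),
            wExt * (rwZ E a y).toReal
          ≤ ∑ a ∈ Finset.univ.filter (fun u : ↥((verts E : Finset (Site 2)) : Set (Site 2)) ↦ u.1 ∈ arcVerts E d₀ n j),
            (rwZ E a y).toReal * ((mass E a.1 - (graph E).degree a) * N a + α a * (1 - N a)) := by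
            refine Finset.sum_le_sum fun a ha ↦ ?_
            have ha' : a.1 ∈ arcVerts E d₀ n j := by simpa using ha
            have hκ : wExt ≤ mass E a.1 - (graph E).degree a :=
              wExt_le_mass_sub_degree hE (arcVerts_subset_bdVerts h.isExtDart j ha')
            have hαa := hαA a ha'
            have h0 := hN0 a
            have h1 := hN1 a
            have hcoef : wExt ≤ (mass E a.1 - (graph E).degree a) * N a + α a * (1 - N a) := by nlinarith
            rw [mul_comm]
            exact mul_le_mul_of_nonneg_left hcoef (hZ0 a)
        _ ≤ _ := Finset.sum_le_sum_of_subset_of_nonneg (Finset.subset_univ _) fun u _ _ ↦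
            mul_nonneg (hZ0 u) (add_nonneg (mul_nonneg (hκ0 u) (hN0 u))
              (mul_nonneg (hα0 u) (by linarith [hN1 u])))
    linarith [hlow, hident]
  -- (2) summing over the poles
  set FA := Finset.univ.filter (fun u : ↥((verts E : Finset (Site 2)) : Set (Site 2)) ↦ u.1 ∈ arcVerts E d₀ n j) with hFA
  set FC := Finset.univ.filter (fun u : ↥((verts E : Finset (Site 2)) : Set (Site 2)) ↦ u.1 ∈ arcVerts E d₀ n j') with hFC
  set S : ℝ := ∑ a ∈ FA, ∑ y ∈ FC, (rwZ E a y).toReal with hSdef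
  have hreal : S ≤ (1 + wExt) / wExt ^ 2 * I := by
    have h1 : wExt * S = ∑ y ∈ FC, wExt * ∑ a ∈ FA, (rwZ E a y).toReal := by
      rw [hSdef, Finset.sum_comm, Finset.mul_sum]
    have h2 : ∑ y ∈ FC, wExt * ∑ a ∈ FA, (rwZ E a y).toReal ≤ ∑ y ∈ FC, (N y + ∑ u, γ u * N u * (rwZ E u y).toReal) :=
      Finset.sum_le_sum fun y _ ↦ key y
    have h3 : ∑ y ∈ FC, (N y + ∑ u, γ u * N u * (rwZ E u y).toReal) =
        ∑ y ∈ FC, N y + ∑ u, γ u * N u * ∑ y ∈ FC, (rwZ E u y).toReal := by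
      rw [Finset.sum_add_distrib, Finset.sum_comm]
      simp only [Finset.mul_sum]
    have h4 : ∑ y ∈ FC, N y ≤ I := by
      calc ∑ y ∈ FC, N y ≤ ∑ y ∈ FC, γ y * N y := by
            refine Finset.sum_le_sum fun y hy ↦ ?_
            have hy' : y.1 ∈ arcVerts E d₀ n j' := by simpa [hFC] using hy
            have := hγC y hy'
            have := hN0 y
            nlinarith
        _ ≤ ∑ y, γ y * N y :=
            Finset.sum_le_sum_of_subset_of_nonneg (Finset.subset_univ _) fun u _ _ ↦ mul_nonneg (hγ0 u) (hN0 u)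
    have h5 : ∑ u, γ u * N u * ∑ y ∈ FC, (rwZ E u y).toReal ≤ ∑ u, γ u * N u * wExt⁻¹ :=
      Finset.sum_le_sum fun u _ ↦ mul_le_mul_of_nonneg_left
        (sum_toReal_rwZ_le_inv_wExt hE u fun y hy ↦ arcVerts_subset_bdVerts h.isExtDart j' (by simpa [hFC] using hy))
        (mul_nonneg (hγ0 u) (hN0 u))
    have h6 : ∑ u, γ u * N u * wExt⁻¹ = I * wExt⁻¹ := by rw [← Finset.sum_mul]
    have h7 : wExt * S ≤ I + I * wExt⁻¹ := by linarith [h1.trans_le (h2.trans_eq h3), h4, h5.trans_eq h6]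
    rw [show (1 + wExt) / wExt ^ 2 * I = (I + I * wExt⁻¹) * wExt⁻¹ by field_simp; ring]
    rw [le_mul_inv_iff₀ hw]
    linarith
  -- (3) the current is at most the conductance of `Ω̄`
  have hIle : ENNReal.ofReal I ≤ effectiveConductance (extGraph E) 1 (extArc E d₀ n j) (extArc E d₀ n j') := by
    refine le_effectiveConductance fun F hF1 hF0 ↦ ?_
    set f : ↥((verts E : Finset (Site 2)) : Set (Site 2)) → ℝ := fun x ↦ F (.inl x.1) with hf
    have hQN := penalised_energy_eq (graph E) hN
    have hQ : I ≤ ∑ e ∈ (graph E).edgeFinset, ((1 : Sym2 ↥((verts E : Finset (Site 2)) : Set (Site 2)) → ℝ≥0) e : ℝ) *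
        sqIncr f e + ∑ u, (α u * (1 - f u) ^ 2 + γ u * f u ^ 2) := by
      rw [← hI', ← hQN]
      exact penalised_energy_le (graph E) hα0 hγ0 hN f
    have hpen1 : ∀ i ∈ Ij, F (.inr ((succ E)^[i] d₀)) = 1 := fun i hi ↦
      hF1 ⟨i, (Finset.mem_Ico.1 hi).1, (Finset.mem_Ico.1 hi).2, rfl⟩
    have hpen0 : ∀ i ∈ Ij', F (.inr ((succ E)^[i] d₀)) = 0 := fun i hi ↦
      hF0 ⟨i, (Finset.mem_Ico.1 hi).1, (Finset.mem_Ico.1 hi).2, rfl⟩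
    have hregroup : ∑ u, (α u * (1 - f u) ^ 2 + γ u * f u ^ 2) =
        ∑ i ∈ Ij ∪ Ij', (F (.inl ((succ E)^[i] d₀).1) - F (.inr ((succ E)^[i] d₀))) ^ 2 := by
      have e1 : ∑ u, α u * (1 - f u) ^ 2 = ∑ i ∈ Ij, (1 - f (base i)) ^ 2 :=
        (hfib Ij (fun u ↦ (1 - f u) ^ 2)).symm
      have e2 : ∑ u, γ u * f u ^ 2 = ∑ i ∈ Ij', f (base i) ^ 2 := (hfib Ij' (fun u ↦ f u ^ 2)).symm
      have e3 : ∑ i ∈ Ij, (1 - f (base i)) ^ 2 =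
          ∑ i ∈ Ij, (F (.inl ((succ E)^[i] d₀).1) - F (.inr ((succ E)^[i] d₀))) ^ 2 :=
        Finset.sum_congr rfl fun i hi ↦ by rw [hpen1 i hi]; simp only [hf, hbase]; ring
      have e4 : ∑ i ∈ Ij', f (base i) ^ 2 =
          ∑ i ∈ Ij', (F (.inl ((succ E)^[i] d₀).1) - F (.inr ((succ E)^[i] d₀))) ^ 2 :=
        Finset.sum_congr rfl fun i hi ↦ by rw [hpen0 i hi]; simp only [hf, hbase]; ring
      rw [Finset.sum_add_distrib, e1, e2, e3, e4, Finset.sum_union (Ico_lo_disjoint hjj')]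
    have hnonneg1 : 0 ≤ ∑ e ∈ (graph E).edgeFinset,
        ((1 : Sym2 ↥((verts E : Finset (Site 2)) : Set (Site 2)) → ℝ≥0) e : ℝ) * sqIncr f e :=
      Finset.sum_nonneg fun e _ ↦ mul_nonneg (NNReal.coe_nonneg _) (sqIncr_nonneg f e)
    calc ENNReal.ofReal I
        ≤ ENNReal.ofReal (∑ e ∈ (graph E).edgeFinset,
            ((1 : Sym2 ↥((verts E : Finset (Site 2)) : Set (Site 2)) → ℝ≥0) e : ℝ) * sqIncr f e +
            ∑ i ∈ Ij ∪ Ij', (F (.inl ((succ E)^[i] d₀).1) - F (.inr ((succ E)^[i] d₀))) ^ 2) := by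
          rw [← hregroup]; exact ENNReal.ofReal_le_ofReal hQ
      _ = networkEnergy (graph E) 1 f +
            ∑ i ∈ Ij ∪ Ij', ENNReal.ofReal ((F (.inl ((succ E)^[i] d₀).1) - F (.inr ((succ E)^[i] d₀))) ^ 2) := by
          rw [ENNReal.ofReal_add hnonneg1 (Finset.sum_nonneg fun i _ ↦ sq_nonneg _), networkEnergy_eq_ofReal_sum,
            ENNReal.ofReal_sum_of_nonneg fun i _ ↦ sq_nonneg _]
      _ ≤ networkEnergy (extGraph E) 1 F := h.inner_add_pendant_le_networkEnergy_extGraph j j' F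
  -- (4) back to `ℝ≥0∞`
  rw [rwZSets_eq_sum, extResistance, effectiveResistance_inv]
  calc ∑ a ∈ FA, ∑ y ∈ FC, rwZ E a y
      = ENNReal.ofReal S := by
        rw [hSdef, ENNReal.ofReal_sum_of_nonneg (fun a _ ↦ Finset.sum_nonneg fun y _ ↦ ENNReal.toReal_nonneg)]
        refine Finset.sum_congr rfl fun a _ ↦ ?_
        rw [ENNReal.ofReal_sum_of_nonneg (fun y _ ↦ ENNReal.toReal_nonneg)]
        exact Finset.sum_congr rfl fun y _ ↦ (ENNReal.ofReal_toReal (rwZ_ne_top hE a y)).symm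
    _ ≤ ENNReal.ofReal ((1 + wExt) / wExt ^ 2 * I) := ENNReal.ofReal_le_ofReal hreal
    _ = ENNReal.ofReal ((1 + wExt) / wExt ^ 2) * ENNReal.ofReal I := ENNReal.ofReal_mul (by positivity)
    _ ≤ ENNReal.ofReal ((1 + wExt) / wExt ^ 2) * effectiveConductance (extGraph E) 1 (extArc E d₀ n j) (extArc E d₀ n j') :=
        mul_le_mul' le_rfl hIle

/-- **CDH16 Theorem 3.9, second assertion, as printed** ("if `ℓ_Ω̄[(a_ext b_ext),(c_ext d_ext)] ≥ L` then
`Z_Ω[(ab),(cd)] ≤ ζ₂(L)`", `ζ₂` continuous decreasing with `ζ₂(L) → 0` as `L → ∞`), with the explicit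
`ζ₂(L) = (1 + w_ext)/(w_ext² L)`, for every discrete topological rectangle and any two of its arcs
(Chelkak 2016, Prop. 6.6). [cite: ChelkakDuminilCopinHongler2016, Thm. 3.9; Chelkak2016, Prop. 6.6] -/
theorem IsRect.rwZSets_arcVerts_le_of_le_extResistance (h : IsRect E d₀ n) (j j' : Fin 4) {L : ℝ} (hL : 0 < L)
    (hℓ : ENNReal.ofReal L ≤ extResistance E d₀ n j j') :
    rwZSets E {x : ↥((verts E : Finset (Site 2)) : Set (Site 2)) | x.1 ∈ arcVerts E d₀ n j}
        {x | x.1 ∈ arcVerts E d₀ n j'} ≤ ENNReal.ofReal ((1 + wExt) / (wExt ^ 2 * L)) := by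
  have hw := wExt_pos
  calc rwZSets E {x : ↥((verts E : Finset (Site 2)) : Set (Site 2)) | x.1 ∈ arcVerts E d₀ n j}
        {x | x.1 ∈ arcVerts E d₀ n j'}
      ≤ ENNReal.ofReal ((1 + wExt) / wExt ^ 2) * (extResistance E d₀ n j j')⁻¹ :=
        h.rwZSets_arcVerts_le_mul_inv_extResistance j j'
    _ ≤ ENNReal.ofReal ((1 + wExt) / wExt ^ 2) * (ENNReal.ofReal L)⁻¹ := mul_le_mul' le_rfl (ENNReal.inv_le_inv.2 hℓ)
    _ = ENNReal.ofReal ((1 + wExt) / (wExt ^ 2 * L)) := by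
        rw [← ENNReal.ofReal_inv_of_pos hL, ← ENNReal.ofReal_mul (by positivity)]
        congr 1
        rw [div_mul_eq_div_div, div_eq_mul_inv _ L]

end DiscreteRect

end ExtBound

end Literature.Probability.LatticeModels

end
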